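import Literature.NumberTheory.QuadraticFields.GaussianPrimary
import Literature.NumberTheory.LFunctions.GaussianThetaSeries
import Literature.NumberTheory.EllipticCurves.TunnellHalfIntegralForms
import Literature.NumberTheory.EllipticCurves.TunnellThmTwoSupersingularEigenProofs
import Literature.NumberTheory.EllipticCurves.CongruentNumberCurveHeckeSeries
import Literature.NumberTheory.EllipticCurves.CongruentNumberCurveJacobiSums
import Literature.NumberTheory.EllipticCurves.JacobiThetaDerivativeFormula
import HarnessLib

/-!
# Tunnell 1983, Theorem 2 for `g θ₈`: `T(p²)(g θ₈) = a_p(E) · g θ₈` for every odd prime `p` —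
# the ordinary half of the Shimura–Niwa input, by Jacobi's `θ₁' = θ₂ θ₃ θ₄`

In the proof of Theorem 2 of Tunnell 1983 (pp. 327–328) the `T(p²)`-eigenvalues of the
eigenform `g θ₈ = ∑ d₈(n) qⁿ ∈ S_{3/2}(128, 1)` are identified with the eigenvalues `a_p(E)` of
the newform `φ` of level `32` (`E : y² = x³ - x`) through Shimura's correspondence [18] and Niwa
[11]. In the tree, `g θ₈` is known to be a `T(p²)`-eigenform for every odd `p`
(`heckeTSq_tunnellForm_eight_eigen`, `TunnellWeightThreeHalvesBasisProofs`), its eigenvalue is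
the coefficient of `q¹` of `T(p²)(g θ₈)`, namely `d₈(p²) + (-1/p)`, and the identification with
`a_p(E)` was proved at the supersingular primes `p ≡ 3 (mod 4)`
(`TunnellThmTwoSupersingular(Eigen)Proofs`: both sides vanish). This file PROVES the remaining
ordinary half **`d₈(p²) + 1 = a_p(E)` for `p ≡ 1 (mod 4)`** (`formCoeff_eight_prime_sq_ordinary`),
hence **`T(p²)(g θ₈) = a_p(E) · g θ₈` for every odd prime `p`** (`heckeTSq_tunnellForm_eight`),
by an elementary route that replaces the Shimura correspondence by Jacobi's derivative formula
`θ₁' = θ₂ θ₃ θ₄` (`JacobiThetaDerivativeFormula`) and unique factorisation in `ℤ[i]`: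

* **Step A** (`formCoeff_eight_sq_eq_sum`): `d₈(p²) = ∑_{0 ≤ t ≤ p/4} (-1)ᵗ r₂(t(p - 4t))` —
  in `(4m+1)² + 8n² + 8k² = p²` the solutions with `n ≢ k (2)` cancel under `n ↔ k`, and for
  `n ≡ k` one has `4m + 1 = p - 8t`, `((n+k)/2)² + ((n-k)/2)² = t(p - 4t)`, `(-1)ⁿ = (-1)ᵗ`.
* **Step B** (`card_normEq_mul_card_normEq`): `r₂(a) r₂(b) = 4 r₂(ab)` for `gcd(a, b) = 1`
  (`(α, β) ↦ αβ` is `4 : 1` onto; Bézout in `ℤ[i]`).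
* **Steps C–D** (`quadSum_eq_sum_card`, `quadSum_eq_sum_jacobiRHS`, `quadSum_eq_pairSum`,
  `pairSum_eq_two_mul_re_primarySum`): the signed count
  `Q(m) = #±{(n,a,y,z) : (2n+1)² + 4a² + 4y² + 4z² = m}` (sign `(-1)^{y+z}`) equals on the one
  hand `∑_t (-1)ᵗ ½ r₂(m - 4t) r₂(t)` (so `Q(p) = 2 d₈(p²) + 2` by A, B and `r₂(p) = 8`), and on the
  other hand `∑_z (-1)ᶻ J(m - 4z²)` with `J(M) = ∑_{(2n+1)² + 4a² + 4y² = M} (-1)ʸ`, which by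
  **Jacobi's identity** `J(M) = ∑_{(2n+1)² = M} (-1)ⁿ (2n+1)` (the coefficients of
  `θ₁'(0, q⁴) = θ₂ θ₃ θ₄ (0, q⁴)`, i.e. `∑ (-1)ⁿ(2n+1) q^{(2n+1)²} = (∑ q^{(2n+1)²})(∑ q^{4n²})(∑ (-1)ⁿ q^{4n²})`,
  `jacobiRHS_eq_jacobiLHS`, from `JacobiThetaNull.jacobi_derivative_formula` at `τ = 8z`)
  becomes `∑_{(2n+1)² + 4z² = m} (-1)^{n+z} (2n+1) = 2 Re S(m)`, `S(m) = ∑_{x primary, N x = m} x`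
  (`(2n+1) + 2zi` is primary exactly when `n + z` is even).
* **Step E**: `a_p(E) = S(p) = π + π̄` (Ireland–Rosen Thm. 18.5, the tree's
  `lFunction_congruentNumberCurve_eq_jacobiSym_mul_primarySum` with the proved
  `IrelandRosen1990_card_points_one_mod_four_holds`). Hence `d₈(p²) + 1 = a_p(E)`.

So the only remaining input of `Tunnell1983_thm2_triv` (via `Tunnell1983_thm2_triv_of_shimuraNiwa`)
is the analogous identification for the second eigenform `g(θ₂ - θ₈)` (class `3 (mod 8)`), which
is not treated here. No named facts are introduced; the definitions are finite sets / finite sums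
of solutions of quadratic equations and the terms of the four `q`-series at `8z`.

## References

* J. B. Tunnell, *A classical Diophantine problem and modular forms of weight 3/2*, Invent. Math.
  72 (1983) 323–334, Thm 2 and its proof, pp. 327–328. [Tunnell1983Congruent]
* D. F. Lawden, *Elliptic Functions and Applications*, Springer (1989), §1.5, (1.5.7)–(1.5.11)
  (held, PDF p. 51). [Lawden1989]
* K. Ireland, M. Rosen, *A Classical Introduction to Modern Number Theory*, GTM 84, Ch. 18 §4
  Thm 5; Ch. 9 §7 Lemma 7 (primary associates). [IrelandRosen1990]
-/

noncomputable section

namespace Literature.NumberTheory.QuadraticFields.GaussianPrimary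

local notation "ℤ[i]" => GaussianInt

open Zsqrtd Finset
open Literature.NumberTheory.LFunctions.GaussianTheta (normEq mem_normEq normEq_zero)

/-! ### All Gaussian integers of norm `m`: the tree's `GaussianTheta.normEq` -/

/-- `r₂(0) = 1`: `normEq 0 = {0}`. [folklore] -/
theorem card_normEq_zero : (normEq 0).card = 1 := by
  rw [normEq_zero, Finset.card_singleton]

/-- The primary elements of norm `m` are the primary members of `normEq m`. [folklore] -/
theorem primaryNormEq_eq_filter (m : ℕ) : primaryNormEq m = (normEq m).filter IsPrimary := by
  ext x
  rw [mem_primaryNormEq, Finset.mem_filter, mem_normEq]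

/-! ### Units -/

/-- The four units of `ℤ[i]`, as a `Finset`. [folklore] -/
def unitSet : Finset ℤ[i] := {1, -1, ⟨0, 1⟩, ⟨0, -1⟩}

/-- `#unitSet = 4`. [folklore] -/
theorem card_unitSet : unitSet.card = 4 := by decide +kernel

/-- Members of `unitSet` are units. [folklore] -/
theorem isUnit_of_mem_unitSet {u : ℤ[i]} (hu : u ∈ unitSet) : IsUnit u := by
  rw [← Zsqrtd.norm_eq_one_iff' (by norm_num) u]
  simp only [unitSet, Finset.mem_insert, Finset.mem_singleton] at hu
  rcases hu with rfl | rfl | rfl | rfl <;> decide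

/-- Units are members of `unitSet`. [folklore] -/
theorem mem_unitSet_of_isUnit {u : ℤ[i]} (hu : IsUnit u) : u ∈ unitSet := by
  rcases eq_of_isUnit hu with rfl | rfl | rfl | rfl <;> simp [unitSet]

/-- A unit times its conjugate is `1`. [folklore] -/
theorem mul_star_of_isUnit {u : ℤ[i]} (hu : IsUnit u) : u * star u = 1 := by
  have h := (Zsqrtd.norm_eq_one_iff' (by norm_num) u).mpr hu
  have := Zsqrtd.norm_eq_mul_conj u
  rw [h] at this
  exact_mod_cast this.symm

/-- `u ↦ u x` is injective on the units for `x ≠ 0`. [folklore] -/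
theorem injOn_unit_mul {x : ℤ[i]} (hx : x ≠ 0) : Set.InjOn (fun u : ℤ[i] ↦ u * x) unitSet :=
  fun _ _ _ _ h ↦ mul_right_cancel₀ hx h

/-! ### `#normEq a = 4 · #primaryNormEq a` for odd `a` -/

/-- An element of odd norm is prime to `1 + i`. [folklore] -/
theorem parity_of_norm_odd {x : ℤ[i]} {a : ℕ} (ha : a % 2 = 1) (hx : x.norm = a) :
    (x.re + x.im) % 2 = 1 := by
  rw [← norm_emod_two, hx]
  exact_mod_cast ha

/-- The elements with primary associate `y` (primary, of odd norm) are the four associates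
`u y`. [folklore] -/
theorem filter_primary_eq {a : ℕ} (ha : a % 2 = 1) {y : ℤ[i]} (hy : y ∈ primaryNormEq a) :
    (normEq a).filter (fun x ↦ primary x = y) = unitSet.image (fun u ↦ u * y) := by
  obtain ⟨hyn, hyp⟩ := mem_primaryNormEq.mp hy
  ext x
  simp only [Finset.mem_filter, mem_normEq, Finset.mem_image]
  constructor
  · rintro ⟨hxn, hxy⟩
    have hpar := parity_of_norm_odd ha hxn
    obtain ⟨u, hu, hux⟩ := exists_isUnit_primary_eq hpar
    rw [hxy] at hux
    -- `y = u x`, so `x = star u * y`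
    refine ⟨star u, mem_unitSet_of_isUnit hu.star, ?_⟩
    rw [hux, ← mul_assoc, mul_comm (star u), mul_star_of_isUnit hu, one_mul]
  · rintro ⟨u, hu, rfl⟩
    have hu' := isUnit_of_mem_unitSet hu
    refine ⟨?_, ?_⟩
    · rw [Zsqrtd.norm_mul, (Zsqrtd.norm_eq_one_iff' (by norm_num) u).mpr hu', one_mul, hyn]
    · rw [primary_isUnit_mul hu', primary_of_isPrimary hyp]

/-- **`#normEq a = 4 · #primaryNormEq a`** for odd `a`: every element of odd norm has exactly
one primary associate among its four associates (Ireland–Rosen, Ch. 9 §7, Lemma 7). [folklore] -/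
theorem card_normEq_eq_four_mul {a : ℕ} (ha : a % 2 = 1) :
    (normEq a).card = 4 * (primaryNormEq a).card := by
  rw [Finset.card_eq_sum_card_fiberwise (f := primary) (t := primaryNormEq a)]
  · rw [Finset.sum_const_nat (m := 4) fun y hy ↦ ?_, mul_comm]
    rw [filter_primary_eq ha hy, Finset.card_image_of_injOn, card_unitSet]
    exact injOn_unit_mul (mem_primaryNormEq.mp hy).2.ne_zero
  · intro x hx
    rw [Finset.mem_coe, mem_normEq] at hx
    have hpar := parity_of_norm_odd ha hx
    exact Finset.mem_coe.mpr
      (mem_primaryNormEq.mpr ⟨by rw [norm_primary hpar, hx], isPrimary_primary hpar⟩)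

/-- **`r₂(p) = 8`** for a prime `p ≡ 1 (mod 4)`: the primary elements of norm `p` are `π, π̄`.
[folklore] -/
theorem card_normEq_prime {p : ℕ} (hp : p.Prime) (hp1 : p % 4 = 1) : (normEq p).card = 8 := by
  haveI := Fact.mk hp
  obtain ⟨π, hπ, hπp⟩ := exists_isPrimary_norm_eq hp1
  have h := primaryNormEq_pow_of_mod_four_eq_one hp hπ hπp 1
  rw [pow_one] at h
  rw [card_normEq_eq_four_mul (by omega), h, Finset.card_image_of_injOn]
  · simp
  · have := injOn_pow_mul_pow hp hp1 hπp 1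
    simpa using this

/-! ### `re` odd versus `re` even: halves of `normEq a`, `a` odd -/

/-- For odd norm, multiplication by `i` swaps "`re` odd" and "`re` even". [folklore] -/
theorem card_filter_re_odd {a : ℕ} (ha : a % 2 = 1) :
    2 * ((normEq a).filter fun x ↦ x.re % 2 = 1).card = (normEq a).card := by
  have hsplit := Finset.card_filter_add_card_filter_not
    (s := normEq a) (fun x : ℤ[i] ↦ x.re % 2 = 1)
  suffices h : ((normEq a).filter fun x ↦ ¬ x.re % 2 = 1).card =
      ((normEq a).filter fun x ↦ x.re % 2 = 1).card by omega
  symm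
  refine Finset.card_bij (fun x _ ↦ (⟨0, 1⟩ : ℤ[i]) * x) ?_ ?_ ?_
  · intro x hx
    rw [Finset.mem_filter, mem_normEq] at hx ⊢
    have hpar := parity_of_norm_odd ha hx.1
    refine ⟨?_, ?_⟩
    · rw [Zsqrtd.norm_mul, show (⟨0, 1⟩ : ℤ[i]).norm = 1 by decide, one_mul, hx.1]
    · rw [re_I_mul]; omega
  · intro x _ y _ h
    exact mul_left_cancel₀ (by decide) h
  · intro y hy
    rw [Finset.mem_filter, mem_normEq] at hy
    have hpar := parity_of_norm_odd ha hy.1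
    refine ⟨-(⟨0, 1⟩ * y), ?_, ?_⟩
    · rw [Finset.mem_filter, mem_normEq]
      refine ⟨?_, ?_⟩
      · rw [Zsqrtd.norm_neg, Zsqrtd.norm_mul, show (⟨0, 1⟩ : ℤ[i]).norm = 1 by decide, one_mul,
          hy.1]
      · simp only [Zsqrtd.re_neg, re_I_mul]; omega
    · ext <;> simp [Zsqrtd.re_mul, Zsqrtd.im_mul]

/-! ### Pairs of coprime norms: `#normEq a · #normEq b = 4 · #normEq (ab)` -/

/-- `N(n) = n²` for `n : ℕ`. [folklore] -/
theorem norm_natCast' (n : ℕ) : (n : ℤ[i]).norm = n * n := by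
  rw [show (n : ℤ[i]) = ((n : ℤ) : ℤ[i]) by norm_cast, Zsqrtd.norm_intCast]

/-- **Splitting an element of norm `ab`, `gcd(a, b) = 1`**: `γ = α β` with `N(α) = a`,
`N(β) = b` (take `α = gcd(γ, a)`; Bézout in `ℤ[i]` both ways gives `a ∣ N(α) ∣ a`). [folklore] -/
theorem exists_mul_eq_of_coprime {a b : ℕ} (hab : a.Coprime b) (ha : a ≠ 0) {γ : ℤ[i]}
    (hγ : γ.norm = a * b) : ∃ α β : ℤ[i], α.norm = a ∧ β.norm = b ∧ α * β = γ := by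
  set g := EuclideanDomain.gcd γ (a : ℤ[i]) with hg
  have hgγ : g ∣ γ := EuclideanDomain.gcd_dvd_left _ _
  have hga : g ∣ (a : ℤ[i]) := EuclideanDomain.gcd_dvd_right _ _
  -- Bézout
  have hbez : g = γ * EuclideanDomain.gcdA γ a + a * EuclideanDomain.gcdB γ a :=
    EuclideanDomain.gcd_eq_gcd_ab γ a
  -- `a ∣ N(g)` in `ℤ`
  have h1 : (a : ℤ) ∣ g.norm := by
    have hcast : ((g.norm : ℤ) : ℤ[i]) = g * star g := Zsqrtd.norm_eq_mul_conj g
    have hγγ : γ * star γ = ((a * b : ℕ) : ℤ[i]) := by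
      rw [← Zsqrtd.norm_eq_mul_conj, hγ]; norm_cast
    set s := EuclideanDomain.gcdA γ a
    set t := EuclideanDomain.gcdB γ a
    have hstar : star g = star γ * star s + a * star t := by
      rw [hbez, star_add, star_mul, star_mul, star_natCast]; ring
    have hprod : g * star g = (a : ℤ[i]) * (b * (s * star s) + γ * s * star t + t * star γ * star s
        + a * (t * star t)) := by
      rw [hstar, hbez]
      have : γ * star γ = (a : ℤ[i]) * b := by rw [hγγ]; push_cast; ring
      linear_combination (s * star s) * this
    have hdvd : (a : ℤ[i]) ∣ ((g.norm : ℤ) : ℤ[i]) := ⟨_, by rw [hcast, hprod]⟩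
    have : ((a : ℤ) : ℤ[i]) ∣ ((g.norm : ℤ) : ℤ[i]) := by exact_mod_cast hdvd
    exact (Zsqrtd.intCast_dvd_intCast _ _).mp this
  -- `N(g) ∣ a` in `ℤ`
  have h2 : g.norm ∣ (a : ℤ) := by
    have hda : g.norm ∣ (a : ℤ) ^ 2 := by
      have := norm_dvd_norm hga
      rwa [norm_natCast', ← sq, ← Nat.cast_pow] at this
    have hdab : g.norm ∣ (a : ℤ) * b := by
      have := norm_dvd_norm hgγ
      rw [hγ] at this
      exact_mod_cast this
    have hcop : IsCoprime ((a : ℤ) ^ 2) (b : ℤ) :=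
      (Nat.isCoprime_iff_coprime.mpr hab).pow_left
    exact (hcop.of_isCoprime_of_dvd_left hda).dvd_of_dvd_mul_right hdab
  have hgn : g.norm = a :=
    Int.dvd_antisymm (GaussianInt.norm_nonneg g) (by positivity) h2 h1
  obtain ⟨β, hβ⟩ := hgγ
  refine ⟨g, β, hgn, ?_, hβ.symm⟩
  have := congrArg Zsqrtd.norm hβ
  rw [Zsqrtd.norm_mul, hγ, hgn] at this
  have ha' : (a : ℤ) ≠ 0 := by exact_mod_cast ha
  exact (mul_left_cancel₀ ha' this).symm

/-- Elements whose norms are coprime naturals are coprime in `ℤ[i]`. [folklore] -/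
theorem isCoprime_of_norm_coprime {a b : ℕ} (hab : a.Coprime b) {α β : ℤ[i]} (hα : α.norm = a)
    (hβ : β.norm = b) : IsCoprime α β := by
  have hα' : α ∣ (a : ℤ[i]) := by have := self_dvd_norm α; rwa [hα, Int.cast_natCast] at this
  have hβ' : β ∣ (b : ℤ[i]) := by have := self_dvd_norm β; rwa [hβ, Int.cast_natCast] at this
  exact ((isCoprime_natCast hab).of_isCoprime_of_dvd_left hα').of_isCoprime_of_dvd_right hβ'

/-- **The fibre of `(α, β) ↦ α β` over `α₀ β₀`** (norms `a`, `b` coprime) consists of the four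
pairs `(u α₀, ū β₀)`, `u` a unit. [folklore] -/
theorem filter_mul_eq {a b : ℕ} (hab : a.Coprime b) {α₀ β₀ : ℤ[i]} (hα₀ : α₀.norm = a)
    (hβ₀ : β₀.norm = b) (ha : a ≠ 0) :
    (normEq a ×ˢ normEq b).filter (fun q ↦ q.1 * q.2 = α₀ * β₀) =
      unitSet.image (fun u ↦ (u * α₀, star u * β₀)) := by
  have hα₀0 : α₀ ≠ 0 := by
    intro h; rw [h, Zsqrtd.norm_zero] at hα₀; exact ha (by exact_mod_cast hα₀.symm)
  ext ⟨α, β⟩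
  simp only [Finset.mem_filter, Finset.mem_product, mem_normEq, Finset.mem_image, Prod.mk.injEq]
  constructor
  · rintro ⟨⟨hα, hβ⟩, hprod⟩
    -- `α ∣ α₀` and `α₀ ∣ α`
    have h1 : α ∣ α₀ := (isCoprime_of_norm_coprime hab hα hβ₀).dvd_of_dvd_mul_right
      ⟨β, by rw [hprod]⟩
    have h2 : α₀ ∣ α := (isCoprime_of_norm_coprime hab hα₀ hβ).dvd_of_dvd_mul_right
      ⟨β₀, by rw [← hprod]⟩
    obtain ⟨c, hc⟩ := h2
    obtain ⟨c', hc'⟩ := h1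
    have hcc' : c * c' = 1 := by
      have : α₀ * (c * c') = α₀ * 1 := by rw [← mul_assoc, ← hc, ← hc', mul_one]
      exact mul_left_cancel₀ hα₀0 this
    have hcu : IsUnit c := isUnit_iff_exists_inv.mpr ⟨c', hcc'⟩
    refine ⟨c, mem_unitSet_of_isUnit hcu, by rw [hc, mul_comm], ?_⟩
    -- `β = star c * β₀`
    have : α₀ * (c * β) = α₀ * β₀ := by rw [← mul_assoc, ← hc, hprod]
    have hcβ : c * β = β₀ := mul_left_cancel₀ hα₀0 this
    rw [← hcβ, ← mul_assoc, mul_comm (star c), mul_star_of_isUnit hcu, one_mul]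
  · rintro ⟨u, hu, rfl, rfl⟩
    have hu' := isUnit_of_mem_unitSet hu
    have hnu : u.norm = 1 := (Zsqrtd.norm_eq_one_iff' (by norm_num) u).mpr hu'
    refine ⟨⟨?_, ?_⟩, ?_⟩
    · rw [Zsqrtd.norm_mul, hnu, one_mul, hα₀]
    · rw [Zsqrtd.norm_mul, Zsqrtd.norm_conj, hnu, one_mul, hβ₀]
    · calc u * α₀ * (star u * β₀) = (u * star u) * (α₀ * β₀) := by ring
        _ = α₀ * β₀ := by rw [mul_star_of_isUnit hu', one_mul]

/-- **`#normEq a · #normEq b = 4 · #normEq (ab)`** for coprime `a ≥ 1`, `b`: the map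
`(α, β) ↦ α β` is `4 : 1` onto (unique factorisation in `ℤ[i]`). Equivalently
`r₂(a) r₂(b) = 4 r₂(ab)`. [folklore] -/
theorem card_normEq_mul_card_normEq {a b : ℕ} (hab : a.Coprime b) (ha : a ≠ 0) :
    (normEq a).card * (normEq b).card = 4 * (normEq (a * b)).card := by
  rw [← Finset.card_product]
  rw [Finset.card_eq_sum_card_fiberwise (f := fun q : ℤ[i] × ℤ[i] ↦ q.1 * q.2)
    (t := normEq (a * b))]
  · rw [Finset.sum_const_nat (m := 4) fun γ hγ ↦ ?_, mul_comm]
    rw [mem_normEq] at hγ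
    obtain ⟨α₀, β₀, hα₀, hβ₀, rfl⟩ := exists_mul_eq_of_coprime hab ha (by exact_mod_cast hγ)
    rw [filter_mul_eq hab hα₀ hβ₀ ha, Finset.card_image_of_injOn, card_unitSet]
    intro u hu v hv h
    have hα₀0 : α₀ ≠ 0 := by
      intro h0; rw [h0, Zsqrtd.norm_zero] at hα₀; exact ha (by exact_mod_cast hα₀.symm)
    exact mul_right_cancel₀ hα₀0 (congrArg Prod.fst h)
  · rintro ⟨α, β⟩ hq
    rw [Finset.mem_coe, Finset.mem_product, mem_normEq, mem_normEq] at hq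
    show α * β ∈ (normEq (a * b) : Set ℤ[i])
    rw [Finset.mem_coe, mem_normEq, Zsqrtd.norm_mul, hq.1, hq.2]
    push_cast
    ring

end Literature.NumberTheory.QuadraticFields.GaussianPrimary

/-! ## Step A — `d₈(p²)` as a signed sum of `r₂(t(p - 4t))` -/

namespace Literature.NumberTheory.EllipticCurves.Tunnell1983

local notation "ℤ[i]" => GaussianInt

open Literature.NumberTheory.QuadraticFields.GaussianPrimary Finset
open Literature.NumberTheory.LFunctions.GaussianTheta (normEq mem_normEq normEq_zero)

/-- Squares keep parity. [folklore] -/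
theorem sq_emod_two (u : ℤ) : u ^ 2 % 2 = u % 2 := by
  rcases Int.emod_two_eq_zero_or_one u with h | h <;> simp [pow_two, Int.mul_emod, h]

/-- `(-1)^{|n|}` only depends on `n mod 2`. [folklore] -/
theorem neg_one_pow_natAbs_eq {n : ℤ} {t : ℕ} (h : n % 2 = (t : ℤ) % 2) :
    (-1 : ℤ) ^ n.natAbs = (-1) ^ t := by
  rw [neg_one_pow_eq_pow_mod_two (n := n.natAbs), neg_one_pow_eq_pow_mod_two (n := t)]
  congr 1
  omega

/-- The sign `(-1)^{|n|} + (-1)^{|k|} = 0` when `n + k` is odd. [folklore] -/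
theorem neg_one_pow_natAbs_add_eq_zero {n k : ℤ} (h : (n + k) % 2 = 1) :
    (-1 : ℤ) ^ k.natAbs + (-1) ^ n.natAbs = 0 := by
  rw [neg_one_pow_eq_pow_mod_two (n := k.natAbs), neg_one_pow_eq_pow_mod_two (n := n.natAbs)]
  rcases Int.emod_two_eq_zero_or_one n with hn | hn
  · have hk : k % 2 = 1 := by omega
    rw [show k.natAbs % 2 = 1 by omega, show n.natAbs % 2 = 0 by omega]; norm_num
  · have hk : k % 2 = 0 := by omega
    rw [show k.natAbs % 2 = 0 by omega, show n.natAbs % 2 = 1 by omega]; norm_num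

section StepA

variable {p : ℕ}

/-- Structure of the solutions of `(4m+1)² + 8n² + 8k² = p²` with `n ≡ k (mod 2)`, `p ≡ 1 (mod 4)`:
`4m + 1 = p - 8t` with `0 ≤ 4t ≤ p` and `((n+k)/2)² + ((n-k)/2)² = t(p - 4t)`. [folklore] -/
theorem fiber_even_structure (hp1 : p % 4 = 1) {v : (ℤ × ℤ) × ℤ} (hv : v ∈ fiber 8 (p ^ 2))
    (hP : (v.1.2 + v.2) % 2 = 0) :
    ∃ t : ℕ, 4 * t ≤ p ∧ (4 * v.1.1 + 1 : ℤ) = p - 8 * t ∧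
      ((v.1.2 + v.2) / 2) ^ 2 + ((v.1.2 - v.2) / 2) ^ 2 = t * ((p : ℤ) - 4 * t) := by
  rw [mem_fiber (by norm_num)] at hv
  unfold expo at hv
  push_cast at hv
  obtain ⟨u, hu⟩ : ∃ u, v.1.2 + v.2 = 2 * u := ⟨(v.1.2 + v.2) / 2, by omega⟩
  obtain ⟨w, hw⟩ : ∃ w, v.1.2 - v.2 = 2 * w := ⟨(v.1.2 - v.2) / 2, by omega⟩
  have hn : (v.1.2 : ℤ) = u + w := by omega
  have hk : (v.2 : ℤ) = u - w := by omega
  have hp1' : (p : ℤ) % 4 = 1 := by exact_mod_cast hp1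
  have hppos : (0 : ℤ) ≤ p := by positivity
  rw [hn, hk] at hv
  -- the equation in terms of `x = 4m+1, u, w`
  have heq : (4 * v.1.1 + 1) ^ 2 + 16 * (u ^ 2 + w ^ 2) = (p : ℤ) ^ 2 := by linear_combination hv
  have hx2 : (4 * v.1.1 + 1) ^ 2 ≤ (p : ℤ) ^ 2 := by nlinarith [sq_nonneg u, sq_nonneg w]
  have hxle : 4 * v.1.1 + 1 ≤ (p : ℤ) := by nlinarith
  have hxge : -(p : ℤ) ≤ 4 * v.1.1 + 1 := by nlinarith
  -- `p - x = 4c`, `p + x = 2d` with `d` odd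
  obtain ⟨c, hc⟩ : ∃ c, (p : ℤ) - (4 * v.1.1 + 1) = 4 * c := ⟨((p : ℤ) - (4 * v.1.1 + 1)) / 4, by omega⟩
  obtain ⟨d, hd⟩ : ∃ d, (p : ℤ) + (4 * v.1.1 + 1) = 2 * d := ⟨((p : ℤ) + (4 * v.1.1 + 1)) / 2, by omega⟩
  have hdodd : d % 2 = 1 := by omega
  have hcd : c * d = 2 * (u ^ 2 + w ^ 2) := by nlinarith
  have hceven : c % 2 = 0 := by
    have : Even (c * d) := ⟨u ^ 2 + w ^ 2, by rw [hcd]; ring⟩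
    rcases Int.even_mul.mp this with h | h
    · exact Int.even_iff.mp h
    · exact absurd (Int.even_iff.mp h) (by omega)
  obtain ⟨t, ht⟩ : ∃ t : ℤ, c = 2 * t := ⟨c / 2, by omega⟩
  have ht0 : 0 ≤ t := by omega
  have ht4 : 4 * t ≤ p := by omega
  have hcast : ((t.toNat : ℕ) : ℤ) = t := Int.toNat_of_nonneg ht0
  refine ⟨t.toNat, by omega, by omega, ?_⟩
  rw [hcast, show (v.1.2 + v.2) / 2 = u by omega, show (v.1.2 - v.2) / 2 = w by omega]
  nlinarith

/-- **Step A.** `d₈(p²) = ∑_{0 ≤ t ≤ p/4} (-1)ᵗ r₂(t(p - 4t))` for `p ≡ 1 (mod 4)`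
(`x = 4m+1 = p - 8t` in `(4m+1)² + 8n² + 8k² = p²`; the solutions with `n ≢ k (mod 2)` cancel in
pairs under `n ↔ k`, those with `n ≡ k` correspond to `((n+k)/2, (n-k)/2)` of norm `t(p-4t)`,
with sign `(-1)ⁿ = (-1)ᵗ`). [folklore] -/
theorem formCoeff_eight_sq_eq_sum (hp1 : p % 4 = 1) :
    formCoeff 8 (p ^ 2) =
      ∑ t ∈ Finset.range (p / 4 + 1), (-1 : ℤ) ^ t * ((normEq (t * (p - 4 * t))).card : ℤ) := by
  classical
  rw [formCoeff_eq_sum_fiber]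
  set F := fiber 8 (p ^ 2) with hF
  rw [← Finset.sum_filter_add_sum_filter_not F (fun v ↦ (v.1.2 + v.2) % 2 = 0)]
  have hp1' : (p : ℤ) % 4 = 1 := by exact_mod_cast hp1
  -- the odd part cancels
  have hodd : ∑ v ∈ F.filter (fun v ↦ ¬ (v.1.2 + v.2) % 2 = 0), (-1 : ℤ) ^ v.1.2.natAbs = 0 := by
    refine Finset.sum_involution (fun v _ ↦ ((v.1.1, v.2), v.1.2)) ?_ ?_ ?_ ?_
    · intro v hv
      simp only [Finset.mem_filter] at hv
      refine neg_one_pow_natAbs_add_eq_zero ?_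
      show (v.2 + v.1.2) % 2 = 1
      omega
    · intro v hv _ heq
      simp only [Finset.mem_filter] at hv
      have h1 : v.2 = v.1.2 := congrArg (fun w : (ℤ × ℤ) × ℤ ↦ w.1.2) heq
      rw [h1] at hv
      omega
    · intro v hv
      simp only [Finset.mem_filter, hF, mem_fiber (by norm_num : (0 : ℕ) < 8)] at hv ⊢
      refine ⟨?_, ?_⟩
      · have := hv.1; unfold expo at this ⊢; push_cast at this ⊢; linarith
      · omega
    · intro v _
      rfl
  rw [hodd, add_zero]
  -- the even part: bijection with `Σ t, normEq (t (p - 4t))`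
  rw [show ∑ t ∈ Finset.range (p / 4 + 1), (-1 : ℤ) ^ t * ((normEq (t * (p - 4 * t))).card : ℤ) =
      ∑ x ∈ (Finset.range (p / 4 + 1)).sigma (fun t ↦ normEq (t * (p - 4 * t))), (-1 : ℤ) ^ x.1 by
    rw [Finset.sum_sigma]
    refine Finset.sum_congr rfl fun t _ ↦ ?_
    simp only [Finset.sum_const, nsmul_eq_mul]
    ring]
  refine Finset.sum_nbij'
    (fun v ↦ (⟨(((p : ℤ) - (4 * v.1.1 + 1)) / 8).toNat, ⟨(v.1.2 + v.2) / 2, (v.1.2 - v.2) / 2⟩⟩ :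
      (_ : ℕ) × ℤ[i]))
    (fun x ↦ ((((p : ℤ) - 8 * x.1 - 1) / 4, x.2.re + x.2.im), x.2.re - x.2.im)) ?_ ?_ ?_ ?_ ?_
  · -- maps into
    intro v hv
    simp only [Finset.mem_filter] at hv
    obtain ⟨t, ht4, hx, hnorm⟩ := fiber_even_structure hp1 hv.1 hv.2
    have ht : (((p : ℤ) - (4 * v.1.1 + 1)) / 8).toNat = t := by rw [hx]; simp
    rw [Finset.mem_sigma]
    show (((p : ℤ) - (4 * v.1.1 + 1)) / 8).toNat ∈ Finset.range (p / 4 + 1) ∧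
      (⟨(v.1.2 + v.2) / 2, (v.1.2 - v.2) / 2⟩ : ℤ[i]) ∈
        normEq ((((p : ℤ) - (4 * v.1.1 + 1)) / 8).toNat * (p - 4 * (((p : ℤ) - (4 * v.1.1 + 1)) / 8).toNat))
    rw [ht, Finset.mem_range, mem_normEq]
    refine ⟨by omega, ?_⟩
    rw [Zsqrtd.norm_def, Nat.cast_mul, Nat.cast_sub (by omega)]
    push_cast
    linarith [hnorm]
  · -- maps back
    rintro ⟨t, ω⟩ hx
    simp only [Finset.mem_sigma, Finset.mem_range, mem_normEq] at hx
    obtain ⟨ht, hω⟩ := hx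
    have ht4 : 4 * t ≤ p := by omega
    rw [Zsqrtd.norm_def, Nat.cast_mul, Nat.cast_sub ht4] at hω
    push_cast at hω
    simp only [Finset.mem_filter, hF, mem_fiber (by norm_num : (0 : ℕ) < 8)]
    refine ⟨?_, ?_⟩
    · show (4 * (((p : ℤ) - 8 * t - 1) / 4) + 1) ^ 2 + 8 * (ω.re + ω.im) ^ 2
        + (8 : ℕ) * (ω.re - ω.im) ^ 2 = ((p ^ 2 : ℕ) : ℤ)
      have hm : 4 * (((p : ℤ) - 8 * t - 1) / 4) + 1 = p - 8 * t := by omega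
      rw [hm]
      push_cast
      nlinarith [hω]
    · show (ω.re + ω.im + (ω.re - ω.im)) % 2 = 0
      omega
  · -- left inverse
    intro v hv
    simp only [Finset.mem_filter] at hv
    obtain ⟨t, ht4, hx, hnorm⟩ := fiber_even_structure hp1 hv.1 hv.2
    have hP' : (v.1.2 + v.2) % 2 = 0 := hv.2
    have ht : (((p : ℤ) - (4 * v.1.1 + 1)) / 8).toNat = t := by rw [hx]; simp
    show ((((p : ℤ) - 8 * ((((p : ℤ) - (4 * v.1.1 + 1)) / 8).toNat : ℕ) - 1) / 4,
      (v.1.2 + v.2) / 2 + (v.1.2 - v.2) / 2), (v.1.2 + v.2) / 2 - (v.1.2 - v.2) / 2) = v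
    rw [ht]
    refine Prod.ext (Prod.ext ?_ ?_) ?_
    · show ((p : ℤ) - 8 * (t : ℕ) - 1) / 4 = v.1.1
      omega
    · show (v.1.2 + v.2) / 2 + (v.1.2 - v.2) / 2 = v.1.2
      omega
    · show (v.1.2 + v.2) / 2 - (v.1.2 - v.2) / 2 = v.2
      omega
  · -- right inverse
    rintro ⟨t, ω⟩ hx
    simp only [Finset.mem_sigma, Finset.mem_range] at hx
    have hm : 4 * (((p : ℤ) - 8 * t - 1) / 4) + 1 = p - 8 * t := by omega
    show (⟨(((p : ℤ) - (4 * (((p : ℤ) - 8 * t - 1) / 4) + 1)) / 8).toNat,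
        ⟨(ω.re + ω.im + (ω.re - ω.im)) / 2, (ω.re + ω.im - (ω.re - ω.im)) / 2⟩⟩ :
        (_ : ℕ) × ℤ[i]) = ⟨t, ω⟩
    rw [hm, show ((p : ℤ) - (p - 8 * t)) / 8 = t by omega, Int.toNat_natCast,
      show (ω.re + ω.im + (ω.re - ω.im)) / 2 = ω.re by omega,
      show (ω.re + ω.im - (ω.re - ω.im)) / 2 = ω.im by omega]
  · -- summands
    intro v hv
    simp only [Finset.mem_filter] at hv
    obtain ⟨t, ht4, hx, hnorm⟩ := fiber_even_structure hp1 hv.1 hv.2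
    have ht : (((p : ℤ) - (4 * v.1.1 + 1)) / 8).toNat = t := by rw [hx]; simp
    show (-1 : ℤ) ^ v.1.2.natAbs = (-1) ^ (((p : ℤ) - (4 * v.1.1 + 1)) / 8).toNat
    rw [ht]
    apply neg_one_pow_natAbs_eq
    -- `n ≡ u + w ≡ u² + w² = t (p - 4t) ≡ t (mod 2)`
    have hP' : (v.1.2 + v.2) % 2 = 0 := hv.2
    set u := (v.1.2 + v.2) / 2
    set w := (v.1.2 - v.2) / 2
    have hn : v.1.2 = u + w := by omega
    have h1 : (u + w) % 2 = (u ^ 2 + w ^ 2) % 2 := by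
      rw [Int.add_emod, Int.add_emod (u ^ 2), sq_emod_two, sq_emod_two]
    have h2 : (t * ((p : ℤ) - 4 * t)) % 2 = (t : ℤ) % 2 := by
      have : ((p : ℤ) - 4 * t) % 2 = 1 := by omega
      rw [Int.mul_emod, this, mul_one, Int.emod_emod_of_dvd _ (by norm_num)]
    rw [hn, h1, hnorm, h2]

end StepA

end Literature.NumberTheory.EllipticCurves.Tunnell1983

/-! ## The quadruple count two ways -/

namespace Literature.NumberTheory.EllipticCurves.Tunnell1983

local notation "ℤ[i]" => GaussianInt

open Literature.NumberTheory.QuadraticFields.GaussianPrimary Finset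
open Literature.NumberTheory.LFunctions.GaussianTheta (normEq mem_normEq normEq_zero)

/-! ### The two sides of Jacobi's identity at `τ = 8z`, as arithmetic functions -/

/-- `J_L(M) = ∑_{n ∈ ℤ, (2n+1)² = M} (-1)ⁿ (2n+1)`: the coefficient of `q^M` in
`θ₁'(0, q⁴)/… = ∑ (-1)ⁿ (2n+1) q^{(2n+1)²}` (Lawden (1.5.7) at `q ↦ q⁴`): `2(-1)^{(t-1)/2} t` if
`M = t²` with `t` odd, `0` otherwise. [folklore] -/
def jacobiLHS (M : ℕ) : ℤ :=
  ∑ n ∈ Finset.Icc (-(M : ℤ)) M, if (2 * n + 1) ^ 2 = (M : ℤ) then (-1) ^ n.natAbs * (2 * n + 1) else 0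

/-- `J_R(M) = ∑_{(n, a, y) ∈ ℤ³, (2n+1)² + 4a² + 4y² = M} (-1)ʸ`: the coefficient of `q^M` in
`θ₂(0, q⁴) θ₃(0, q⁴) θ₄(0, q⁴) = (∑ q^{(2n+1)²}) (∑ q^{4a²}) (∑ (-1)ʸ q^{4y²})`
(Lawden (1.5.8)–(1.5.10) at `q ↦ q⁴`). [folklore] -/
def jacobiRHS (M : ℕ) : ℤ :=
  ∑ v ∈ (Finset.Icc (-(M : ℤ)) M ×ˢ Finset.Icc (-(M : ℤ)) M) ×ˢ Finset.Icc (-(M : ℤ)) M,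
    if (2 * v.1.1 + 1) ^ 2 + 4 * v.1.2 ^ 2 + 4 * v.2 ^ 2 = (M : ℤ) then (-1) ^ v.2.natAbs else 0

/-- `|n| ≤ (2n+1)²`. [folklore] -/
theorem natAbs_le_sq_two_mul_add_one (n : ℤ) : (n.natAbs : ℤ) ≤ (2 * n + 1) ^ 2 := by
  rcases le_or_gt 0 n with h | h
  · rw [Int.natAbs_of_nonneg h]; nlinarith
  · rw [Int.ofNat_natAbs_of_nonpos h.le]; nlinarith

/-- `|a| ≤ 4a²`. [folklore] -/
theorem natAbs_le_four_mul_sq (a : ℤ) : (a.natAbs : ℤ) ≤ 4 * a ^ 2 := by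
  have := Int.natAbs_le_self_sq a
  nlinarith [sq_nonneg a]

/-- The solutions of `(2n+1)² + 4a² + 4y² = M`. [folklore] -/
def tripleSet (M : ℕ) : Finset ((ℤ × ℤ) × ℤ) :=
  ((Finset.Icc (-(M : ℤ)) M ×ˢ Finset.Icc (-(M : ℤ)) M) ×ˢ Finset.Icc (-(M : ℤ)) M).filter
    fun v ↦ (2 * v.1.1 + 1) ^ 2 + 4 * v.1.2 ^ 2 + 4 * v.2 ^ 2 = (M : ℤ)

/-- Membership in `tripleSet` is the equation. [folklore] -/
theorem mem_tripleSet {M : ℕ} {v : (ℤ × ℤ) × ℤ} :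
    v ∈ tripleSet M ↔ (2 * v.1.1 + 1) ^ 2 + 4 * v.1.2 ^ 2 + 4 * v.2 ^ 2 = (M : ℤ) := by
  simp only [tripleSet, Finset.mem_filter, Finset.mem_product, Finset.mem_Icc, and_iff_right_iff_imp]
  intro h
  have h1 := natAbs_le_sq_two_mul_add_one v.1.1
  have h2 := natAbs_le_four_mul_sq v.1.2
  have h3 := natAbs_le_four_mul_sq v.2
  have e1 : (v.1.1.natAbs : ℤ) ≤ M := by nlinarith [sq_nonneg v.1.2, sq_nonneg v.2]
  have e2 : (v.1.2.natAbs : ℤ) ≤ M := by nlinarith [sq_nonneg (2 * v.1.1 + 1), sq_nonneg v.2]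
  have e3 : (v.2.natAbs : ℤ) ≤ M := by nlinarith [sq_nonneg (2 * v.1.1 + 1), sq_nonneg v.1.2]
  refine ⟨⟨?_, ?_⟩, ?_⟩ <;> constructor <;> omega

/-- `J_R(M)` as a sum over `tripleSet M`. [folklore] -/
theorem jacobiRHS_eq_sum (M : ℕ) : jacobiRHS M = ∑ v ∈ tripleSet M, (-1 : ℤ) ^ v.2.natAbs := by
  rw [jacobiRHS, tripleSet, Finset.sum_filter]

/-- The solutions of `(2n+1)² = M` (zero or two of them). [folklore] -/
def singleSet (M : ℕ) : Finset ℤ := (Finset.Icc (-(M : ℤ)) M).filter fun n ↦ (2 * n + 1) ^ 2 = (M : ℤ)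

/-- Membership in `singleSet` is the equation. [folklore] -/
theorem mem_singleSet {M : ℕ} {n : ℤ} : n ∈ singleSet M ↔ (2 * n + 1) ^ 2 = (M : ℤ) := by
  simp only [singleSet, Finset.mem_filter, Finset.mem_Icc, and_iff_right_iff_imp]
  intro h
  have h1 := natAbs_le_sq_two_mul_add_one n
  constructor <;> omega

/-- `J_L(M)` as a sum over `singleSet M`. [folklore] -/
theorem jacobiLHS_eq_sum (M : ℕ) :
    jacobiLHS M = ∑ n ∈ singleSet M, (-1 : ℤ) ^ n.natAbs * (2 * n + 1) := by
  rw [jacobiLHS, singleSet, Finset.sum_filter]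

/-- The solutions of `(2n+1)² + 4a² + 4y² + 4z² = m`, as `((n, a), y), z`. [folklore] -/
def quadSet (m : ℕ) : Finset (((ℤ × ℤ) × ℤ) × ℤ) :=
  (((Finset.Icc (-(m : ℤ)) m ×ˢ Finset.Icc (-(m : ℤ)) m) ×ˢ Finset.Icc (-(m : ℤ)) m) ×ˢ
      Finset.Icc (-(m : ℤ)) m).filter
    fun w ↦ (2 * w.1.1.1 + 1) ^ 2 + 4 * w.1.1.2 ^ 2 + 4 * w.1.2 ^ 2 + 4 * w.2 ^ 2 = (m : ℤ)

/-- Membership in `quadSet` is the equation. [folklore] -/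
theorem mem_quadSet {m : ℕ} {w : ((ℤ × ℤ) × ℤ) × ℤ} :
    w ∈ quadSet m ↔ (2 * w.1.1.1 + 1) ^ 2 + 4 * w.1.1.2 ^ 2 + 4 * w.1.2 ^ 2 + 4 * w.2 ^ 2 = (m : ℤ) := by
  simp only [quadSet, Finset.mem_filter, Finset.mem_product, Finset.mem_Icc, and_iff_right_iff_imp]
  intro h
  have h1 := natAbs_le_sq_two_mul_add_one w.1.1.1
  have h2 := natAbs_le_four_mul_sq w.1.1.2
  have h3 := natAbs_le_four_mul_sq w.1.2
  have h4 := natAbs_le_four_mul_sq w.2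
  have e1 : (w.1.1.1.natAbs : ℤ) ≤ m := by nlinarith [sq_nonneg w.1.1.2, sq_nonneg w.1.2, sq_nonneg w.2]
  have e2 : (w.1.1.2.natAbs : ℤ) ≤ m := by
    nlinarith [sq_nonneg (2 * w.1.1.1 + 1), sq_nonneg w.1.2, sq_nonneg w.2]
  have e3 : (w.1.2.natAbs : ℤ) ≤ m := by
    nlinarith [sq_nonneg (2 * w.1.1.1 + 1), sq_nonneg w.1.1.2, sq_nonneg w.2]
  have e4 : (w.2.natAbs : ℤ) ≤ m := by
    nlinarith [sq_nonneg (2 * w.1.1.1 + 1), sq_nonneg w.1.1.2, sq_nonneg w.1.2]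
  refine ⟨⟨⟨?_, ?_⟩, ?_⟩, ?_⟩ <;> constructor <;> omega

/-- The solutions of `(2n+1)² + 4z² = m`, as `(n, z)`. [folklore] -/
def pairSet (m : ℕ) : Finset (ℤ × ℤ) :=
  (Finset.Icc (-(m : ℤ)) m ×ˢ Finset.Icc (-(m : ℤ)) m).filter
    fun q ↦ (2 * q.1 + 1) ^ 2 + 4 * q.2 ^ 2 = (m : ℤ)

/-- Membership in `pairSet` is the equation. [folklore] -/
theorem mem_pairSet {m : ℕ} {q : ℤ × ℤ} : q ∈ pairSet m ↔ (2 * q.1 + 1) ^ 2 + 4 * q.2 ^ 2 = (m : ℤ) := by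
  simp only [pairSet, Finset.mem_filter, Finset.mem_product, Finset.mem_Icc, and_iff_right_iff_imp]
  intro h
  have h1 := natAbs_le_sq_two_mul_add_one q.1
  have h2 := natAbs_le_four_mul_sq q.2
  have e1 : (q.1.natAbs : ℤ) ≤ m := by nlinarith [sq_nonneg q.2]
  have e2 : (q.2.natAbs : ℤ) ≤ m := by nlinarith [sq_nonneg (2 * q.1 + 1)]
  refine ⟨?_, ?_⟩ <;> constructor <;> omega

/-- The elements of norm `M` with odd real part. [folklore] -/
def oddRe (M : ℕ) : Finset ℤ[i] := (normEq M).filter fun x ↦ x.re % 2 = 1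

/-- The signed quadruple count `Q(m) = ∑_{(2n+1)² + 4a² + 4y² + 4z² = m} (-1)^{y+z}`. [folklore] -/
def quadSum (m : ℕ) : ℤ := ∑ w ∈ quadSet m, (-1 : ℤ) ^ w.1.2.natAbs * (-1) ^ w.2.natAbs

/-- Casting a truncated difference `m - 4z²` back to `ℤ` when `4z² ≤ m`. [folklore] -/
theorem cast_sub_four_mul_sq {m : ℕ} {z : ℤ} (h : 4 * z ^ 2 ≤ (m : ℤ)) :
    ((m - 4 * z.natAbs ^ 2 : ℕ) : ℤ) = m - 4 * z ^ 2 := by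
  have hle : 4 * z.natAbs ^ 2 ≤ m := by
    have : ((4 * z.natAbs ^ 2 : ℕ) : ℤ) ≤ m := by push_cast; rw [sq_abs]; exact h
    exact_mod_cast this
  rw [Nat.cast_sub hle]
  push_cast
  rw [sq_abs]

/-- If `4z² > m` then the truncated difference `m - 4z²` is `0` (and nothing solves the
equations with right side `0`). [folklore] -/
theorem sub_eq_zero_of_lt {m : ℕ} {z : ℤ} (h : (m : ℤ) < 4 * z ^ 2) : m - 4 * z.natAbs ^ 2 = 0 := by
  apply Nat.sub_eq_zero_of_le
  have : (m : ℤ) ≤ ((4 * z.natAbs ^ 2 : ℕ) : ℤ) := by push_cast; rw [sq_abs]; exact h.le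
  exact_mod_cast this

/-- `(2n+1)² > 0`. [folklore] -/
theorem sq_two_mul_add_one_pos (n : ℤ) : 0 < (2 * n + 1) ^ 2 :=
  lt_of_le_of_ne (sq_nonneg _) (Ne.symm (pow_ne_zero 2 (by omega)))

/-! ### (E2) `Q(m)` through Jacobi's identity: `Q(m) = ∑_z (-1)ᶻ J_R(m - 4z²)` -/

/-- **`Q(m) = ∑_{z} (-1)ᶻ J_R(m - 4z²)`** (group the quadruples by `z`). [folklore] -/
theorem quadSum_eq_sum_jacobiRHS (m : ℕ) :
    quadSum m = ∑ z ∈ Finset.Icc (-(m : ℤ)) m, (-1 : ℤ) ^ z.natAbs * jacobiRHS (m - 4 * z.natAbs ^ 2) := by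
  have hrhs : ∑ z ∈ Finset.Icc (-(m : ℤ)) m, (-1 : ℤ) ^ z.natAbs * jacobiRHS (m - 4 * z.natAbs ^ 2) =
      ∑ x ∈ (Finset.Icc (-(m : ℤ)) m).sigma (fun z ↦ tripleSet (m - 4 * z.natAbs ^ 2)),
        (-1 : ℤ) ^ x.2.2.natAbs * (-1) ^ x.1.natAbs := by
    rw [Finset.sum_sigma]
    refine Finset.sum_congr rfl fun z _ ↦ ?_
    rw [jacobiRHS_eq_sum, Finset.mul_sum]
    refine Finset.sum_congr rfl fun v _ ↦ ?_
    ring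
  rw [hrhs, quadSum]
  refine Finset.sum_nbij' (fun w ↦ (⟨w.2, w.1⟩ : (_ : ℤ) × ((ℤ × ℤ) × ℤ))) (fun x ↦ (x.2, x.1))
    ?_ ?_ ?_ ?_ ?_
  · intro w hw
    rw [mem_quadSet] at hw
    have hz : 4 * w.2 ^ 2 ≤ (m : ℤ) := by
      nlinarith [sq_nonneg (2 * w.1.1.1 + 1), sq_nonneg w.1.1.2, sq_nonneg w.1.2]
    rw [Finset.mem_sigma]
    show w.2 ∈ Finset.Icc (-(m : ℤ)) m ∧ w.1 ∈ tripleSet (m - 4 * w.2.natAbs ^ 2)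
    rw [mem_tripleSet, cast_sub_four_mul_sq hz, Finset.mem_Icc]
    have := natAbs_le_four_mul_sq w.2
    refine ⟨⟨by omega, by omega⟩, by linarith⟩
  · rintro ⟨z, v⟩ hx
    simp only [Finset.mem_sigma, Finset.mem_Icc, mem_tripleSet] at hx
    obtain ⟨hz, hv⟩ := hx
    show (v, z) ∈ quadSet m
    rw [mem_quadSet]
    rcases le_or_gt (4 * z ^ 2) (m : ℤ) with h | h
    · rw [cast_sub_four_mul_sq h] at hv
      show (2 * v.1.1 + 1) ^ 2 + 4 * v.1.2 ^ 2 + 4 * v.2 ^ 2 + 4 * z ^ 2 = (m : ℤ)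
      linarith
    · exfalso
      rw [sub_eq_zero_of_lt h] at hv
      push_cast at hv
      linarith [sq_nonneg v.1.2, sq_nonneg v.2, sq_two_mul_add_one_pos v.1.1]
  · intro w _
    rfl
  · rintro ⟨z, v⟩ _
    rfl
  · intro w _
    rfl

/-- **`Q(m) = ∑_{(2n+1)² + 4z² = m} (-1)^{n+z} (2n+1)`, given Jacobi's identity `J_R = J_L`.**
[folklore] -/
theorem quadSum_eq_pairSum (hJ : ∀ M : ℕ, jacobiRHS M = jacobiLHS M) (m : ℕ) :
    quadSum m = ∑ q ∈ pairSet m, (-1 : ℤ) ^ q.1.natAbs * (-1) ^ q.2.natAbs * (2 * q.1 + 1) := by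
  rw [quadSum_eq_sum_jacobiRHS]
  simp_rw [hJ, jacobiLHS_eq_sum, Finset.mul_sum]
  have hlhs : ∑ x ∈ (Finset.Icc (-(m : ℤ)) m).sigma (fun z ↦ singleSet (m - 4 * z.natAbs ^ 2)),
      (-1 : ℤ) ^ x.1.natAbs * ((-1) ^ x.2.natAbs * (2 * x.2 + 1)) =
      ∑ z ∈ Finset.Icc (-(m : ℤ)) m, ∑ n ∈ singleSet (m - 4 * z.natAbs ^ 2),
        (-1 : ℤ) ^ z.natAbs * ((-1) ^ n.natAbs * (2 * n + 1)) := by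
    rw [Finset.sum_sigma]
  rw [← hlhs]
  refine Finset.sum_nbij' (fun x ↦ (x.2, x.1)) (fun q ↦ (⟨q.2, q.1⟩ : (_ : ℤ) × ℤ)) ?_ ?_ ?_ ?_ ?_
  · rintro ⟨z, n⟩ hx
    simp only [Finset.mem_sigma, Finset.mem_Icc, mem_singleSet] at hx
    obtain ⟨hz, hn⟩ := hx
    show (n, z) ∈ pairSet m
    rw [mem_pairSet]
    rcases le_or_gt (4 * z ^ 2) (m : ℤ) with h | h
    · rw [cast_sub_four_mul_sq h] at hn
      show (2 * n + 1) ^ 2 + 4 * z ^ 2 = (m : ℤ)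
      linarith
    · exfalso
      rw [sub_eq_zero_of_lt h] at hn
      push_cast at hn
      linarith [sq_two_mul_add_one_pos n]
  · intro q hq
    rw [mem_pairSet] at hq
    have hz : 4 * q.2 ^ 2 ≤ (m : ℤ) := by nlinarith [sq_nonneg (2 * q.1 + 1)]
    rw [Finset.mem_sigma]
    show q.2 ∈ Finset.Icc (-(m : ℤ)) m ∧ q.1 ∈ singleSet (m - 4 * q.2.natAbs ^ 2)
    rw [mem_singleSet, cast_sub_four_mul_sq hz, Finset.mem_Icc]
    have := natAbs_le_four_mul_sq q.2
    refine ⟨⟨by omega, by omega⟩, by linarith⟩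
  · rintro ⟨z, n⟩ _
    rfl
  · intro q _
    rfl
  · rintro ⟨z, n⟩ _
    show (-1 : ℤ) ^ z.natAbs * ((-1) ^ n.natAbs * (2 * n + 1)) = (-1) ^ n.natAbs * (-1) ^ z.natAbs * (2 * n + 1)
    ring

/-! ### The pair sum is `2 Re S(m)` -/

/-- `re` of a finite sum in `ℤ[i]`. [folklore] -/
theorem re_sum {ι : Type*} (s : Finset ι) (f : ι → ℤ[i]) : (∑ i ∈ s, f i).re = ∑ i ∈ s, (f i).re := by
  classical
  induction s using Finset.induction_on with
  | empty => simp
  | insert a s ha ih => rw [Finset.sum_insert ha, Finset.sum_insert ha, Zsqrtd.re_add, ih]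

/-- The solutions `(n, z)` of `(2n+1)² + 4z² = m` are the Gaussian integers `(2n+1) + 2zi` of norm
`m` with odd real part and even imaginary part; the sign `(-1)^{n+z}` is `+1` exactly when
`(2n+1) + 2zi` is primary, so the signed sum of `2n+1` is `∑_{x} ±re(x) = 2 ∑_{x primary} re x`.
[folklore] -/
theorem pairSum_eq_two_mul_re_primarySum (m : ℕ) :
    ∑ q ∈ pairSet m, (-1 : ℤ) ^ q.1.natAbs * (-1) ^ q.2.natAbs * (2 * q.1 + 1) =
      2 * (primarySum m).re := by
  -- Step 1: transport to `X = {x : N x = m, re odd, im even}` with summand `±re x`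
  set X : Finset ℤ[i] := (normEq m).filter (fun x ↦ x.re % 2 = 1 ∧ x.im % 2 = 0) with hX
  have hmemX : ∀ x : ℤ[i], x ∈ X ↔ x.norm = m ∧ x.re % 2 = 1 ∧ x.im % 2 = 0 := fun x ↦ by
    rw [hX, Finset.mem_filter, mem_normEq]
  set g : ℤ[i] → ℤ := fun x ↦ if IsPrimary x then x.re else -x.re with hg
  have step1 : ∑ q ∈ pairSet m, (-1 : ℤ) ^ q.1.natAbs * (-1) ^ q.2.natAbs * (2 * q.1 + 1) =
      ∑ x ∈ X, g x := by
    refine Finset.sum_nbij' (fun q ↦ (⟨2 * q.1 + 1, 2 * q.2⟩ : ℤ[i])) (fun x ↦ ((x.re - 1) / 2, x.im / 2))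
      ?_ ?_ ?_ ?_ ?_
    · intro q hq
      rw [mem_pairSet] at hq
      rw [hmemX, Zsqrtd.norm_def]
      refine ⟨by linarith, by show (2 * q.1 + 1) % 2 = 1; omega, by show (2 * q.2) % 2 = 0; omega⟩
    · intro x hx
      rw [hmemX, Zsqrtd.norm_def] at hx
      rw [mem_pairSet]
      show (2 * ((x.re - 1) / 2) + 1) ^ 2 + 4 * (x.im / 2) ^ 2 = (m : ℤ)
      have h1 : 2 * ((x.re - 1) / 2) + 1 = x.re := by omega
      have h2 : 2 * (x.im / 2) = x.im := by omega
      rw [h1, show 4 * (x.im / 2) ^ 2 = (2 * (x.im / 2)) ^ 2 by ring, h2]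
      linarith
    · intro q _
      show ((2 * q.1 + 1 - 1) / 2, 2 * q.2 / 2) = q
      ext <;> simp
    · intro x hx
      rw [hmemX] at hx
      ext <;> simp <;> omega
    · intro q hq
      show (-1 : ℤ) ^ q.1.natAbs * (-1) ^ q.2.natAbs * (2 * q.1 + 1) =
        if IsPrimary (⟨2 * q.1 + 1, 2 * q.2⟩ : ℤ[i]) then (2 * q.1 + 1) else -(2 * q.1 + 1)
      unfold IsPrimary
      simp only
      rw [neg_one_pow_eq_pow_mod_two (n := q.1.natAbs), neg_one_pow_eq_pow_mod_two (n := q.2.natAbs)]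
      rcases Int.emod_two_eq_zero_or_one q.1 with h1 | h1 <;>
        rcases Int.emod_two_eq_zero_or_one q.2 with h2 | h2
      · rw [show q.1.natAbs % 2 = 0 by omega, show q.2.natAbs % 2 = 0 by omega, if_pos (by omega)]
        ring
      · rw [show q.1.natAbs % 2 = 0 by omega, show q.2.natAbs % 2 = 1 by omega, if_neg (by omega)]
        ring
      · rw [show q.1.natAbs % 2 = 1 by omega, show q.2.natAbs % 2 = 0 by omega, if_neg (by omega)]
        ring
      · rw [show q.1.natAbs % 2 = 1 by omega, show q.2.natAbs % 2 = 1 by omega, if_pos (by omega)]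
        ring
  rw [step1]
  -- Step 2: split `X` into primary and non-primary; `x ↦ -x` maps the latter onto the former
  rw [← Finset.sum_filter_add_sum_filter_not X IsPrimary]
  have hprim : X.filter IsPrimary = primaryNormEq m := by
    ext x
    rw [Finset.mem_filter, hmemX, mem_primaryNormEq]
    constructor
    · rintro ⟨⟨h1, -, -⟩, h2⟩; exact ⟨h1, h2⟩
    · rintro ⟨h1, h2⟩
      refine ⟨⟨h1, ?_, ?_⟩, h2⟩ <;> · unfold IsPrimary at h2; omega
  have hsum1 : ∑ x ∈ X.filter IsPrimary, g x = (primarySum m).re := by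
    rw [hprim, primarySum, re_sum]
    refine Finset.sum_congr rfl fun x hx ↦ ?_
    rw [mem_primaryNormEq] at hx
    simp only [hg, if_pos hx.2]
  have hsum2 : ∑ x ∈ X.filter (fun x ↦ ¬ IsPrimary x), g x = (primarySum m).re := by
    rw [← hsum1]
    refine Finset.sum_nbij' (fun x ↦ -x) (fun x ↦ -x) ?_ ?_ (fun x _ ↦ neg_neg x) (fun x _ ↦ neg_neg x) ?_
    · intro x hx
      rw [Finset.mem_filter, hmemX] at hx ⊢
      obtain ⟨⟨h1, h2, h3⟩, h4⟩ := hx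
      refine ⟨⟨by rw [Zsqrtd.norm_neg, h1], by simp only [Zsqrtd.re_neg]; omega,
        by simp only [Zsqrtd.im_neg]; omega⟩, ?_⟩
      rw [isPrimary_neg_iff]
      unfold IsPrimary at h4
      omega
    · intro x hx
      rw [Finset.mem_filter, hmemX] at hx ⊢
      obtain ⟨⟨h1, h2, h3⟩, h4⟩ := hx
      refine ⟨⟨by rw [Zsqrtd.norm_neg, h1], by simp only [Zsqrtd.re_neg]; omega,
        by simp only [Zsqrtd.im_neg]; omega⟩, ?_⟩
      rw [isPrimary_neg_iff]
      unfold IsPrimary at h4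
      omega
    · intro x hx
      rw [Finset.mem_filter] at hx
      have hneg : IsPrimary (-x) := by
        rw [hmemX] at hx
        rw [isPrimary_neg_iff]
        unfold IsPrimary at hx
        omega
      simp only [hg, if_neg hx.2, if_pos hneg, Zsqrtd.re_neg]
  rw [hsum1, hsum2]
  ring

/-! ### (E1) `Q(m)` through the product structure: `Q(m) = ∑_t (-1)ᵗ #oddRe(m - 4t) · r₂(t)` -/

/-- **`Q(m) = ∑_{0 ≤ t ≤ m/4} (-1)ᵗ #oddRe(m - 4t) r₂(t)`** for odd `m`: `(n, a, y, z) ↦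
(α, ω) = ((2n+1) + 2ai, y + zi)` with `N α = m - 4t`, `N ω = t`, `(-1)^{y+z} = (-1)ᵗ`. [folklore] -/
theorem quadSum_eq_sum_card {m : ℕ} (hm : m % 2 = 1) :
    quadSum m = ∑ t ∈ Finset.range (m / 4 + 1),
      (-1 : ℤ) ^ t * (((oddRe (m - 4 * t)).card : ℤ) * ((normEq t).card : ℤ)) := by
  have hrhs : ∑ t ∈ Finset.range (m / 4 + 1),
      (-1 : ℤ) ^ t * (((oddRe (m - 4 * t)).card : ℤ) * ((normEq t).card : ℤ)) =
      ∑ x ∈ (Finset.range (m / 4 + 1)).sigma (fun t ↦ oddRe (m - 4 * t) ×ˢ normEq t), (-1 : ℤ) ^ x.1 := by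
    rw [Finset.sum_sigma]
    refine Finset.sum_congr rfl fun t _ ↦ ?_
    simp only [Finset.sum_const, nsmul_eq_mul, Finset.card_product, Nat.cast_mul]
    ring
  rw [hrhs, quadSum]
  have hm' : (m : ℤ) % 2 = 1 := by exact_mod_cast hm
  refine Finset.sum_nbij'
    (fun w ↦ (⟨(w.1.2 ^ 2 + w.2 ^ 2).toNat, ((⟨2 * w.1.1.1 + 1, 2 * w.1.1.2⟩ : ℤ[i]), (⟨w.1.2, w.2⟩ : ℤ[i]))⟩ :
      (_ : ℕ) × (ℤ[i] × ℤ[i])))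
    (fun x ↦ ((((x.2.1.re - 1) / 2, x.2.1.im / 2), x.2.2.re), x.2.2.im)) ?_ ?_ ?_ ?_ ?_
  · intro w hw
    rw [mem_quadSet] at hw
    set t : ℤ := w.1.2 ^ 2 + w.2 ^ 2 with ht
    have ht0 : 0 ≤ t := by positivity
    have htc : ((t.toNat : ℕ) : ℤ) = t := Int.toNat_of_nonneg ht0
    have h4t : 4 * t ≤ (m : ℤ) := by nlinarith [sq_nonneg (2 * w.1.1.1 + 1), sq_nonneg w.1.1.2]
    have h4t' : 4 * t.toNat ≤ m := by omega
    rw [Finset.mem_sigma]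
    show t.toNat ∈ Finset.range (m / 4 + 1) ∧
      ((⟨2 * w.1.1.1 + 1, 2 * w.1.1.2⟩ : ℤ[i]), (⟨w.1.2, w.2⟩ : ℤ[i])) ∈ oddRe (m - 4 * t.toNat) ×ˢ normEq t.toNat
    rw [Finset.mem_range, Finset.mem_product, oddRe, Finset.mem_filter, mem_normEq, mem_normEq,
      Zsqrtd.norm_def, Zsqrtd.norm_def, Nat.cast_sub h4t']
    push_cast
    rw [htc]
    refine ⟨by omega, ⟨by linarith, by show (2 * w.1.1.1 + 1) % 2 = 1; omega⟩, by rw [ht]; ring⟩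
  · rintro ⟨t, α, ω⟩ hx
    simp only [Finset.mem_sigma, Finset.mem_range, Finset.mem_product, oddRe, Finset.mem_filter,
      mem_normEq] at hx
    obtain ⟨ht, ⟨hα, hαre⟩, hω⟩ := hx
    have h4t : 4 * t ≤ m := by omega
    rw [Zsqrtd.norm_def, Nat.cast_sub h4t] at hα
    push_cast at hα
    rw [Zsqrtd.norm_def] at hω
    have hα' : α.re ^ 2 + α.im ^ 2 = (m : ℤ) - 4 * t := by linear_combination hα
    have hω' : ω.re ^ 2 + ω.im ^ 2 = (t : ℤ) := by linear_combination hω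
    -- `im α` is even since `m - 4t` is odd
    have hαim : α.im % 2 = 0 := by
      have h1 := sq_emod_two α.re
      have h2 := sq_emod_two α.im
      omega
    show ((((α.re - 1) / 2, α.im / 2), ω.re), ω.im) ∈ quadSet m
    rw [mem_quadSet]
    show (2 * ((α.re - 1) / 2) + 1) ^ 2 + 4 * (α.im / 2) ^ 2 + 4 * ω.re ^ 2 + 4 * ω.im ^ 2 = (m : ℤ)
    have h1 : 2 * ((α.re - 1) / 2) + 1 = α.re := by omega
    have h2 : 2 * (α.im / 2) = α.im := by omega
    rw [h1, show 4 * (α.im / 2) ^ 2 = (2 * (α.im / 2)) ^ 2 by ring, h2]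
    linear_combination hα' + 4 * hω'
  · intro w _
    show (((((2 * w.1.1.1 + 1) - 1) / 2, 2 * w.1.1.2 / 2), w.1.2), w.2) = w
    ext <;> simp
  · rintro ⟨t, α, ω⟩ hx
    simp only [Finset.mem_sigma, Finset.mem_range, Finset.mem_product, oddRe, Finset.mem_filter,
      mem_normEq] at hx
    obtain ⟨ht, ⟨hα, hαre⟩, hω⟩ := hx
    have h4t : 4 * t ≤ m := by omega
    rw [Zsqrtd.norm_def, Nat.cast_sub h4t] at hα
    push_cast at hα
    rw [Zsqrtd.norm_def] at hω
    have hα' : α.re ^ 2 + α.im ^ 2 = (m : ℤ) - 4 * t := by linear_combination hα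
    have hω' : ω.re ^ 2 + ω.im ^ 2 = (t : ℤ) := by linear_combination hω
    have hαim : α.im % 2 = 0 := by
      have h1 := sq_emod_two α.re
      have h2 := sq_emod_two α.im
      omega
    show (⟨(ω.re ^ 2 + ω.im ^ 2).toNat, ((⟨2 * ((α.re - 1) / 2) + 1, 2 * (α.im / 2)⟩ : ℤ[i]), (⟨ω.re, ω.im⟩ : ℤ[i]))⟩ :
      (_ : ℕ) × (ℤ[i] × ℤ[i])) = ⟨t, α, ω⟩
    have h1 : 2 * ((α.re - 1) / 2) + 1 = α.re := by omega
    have h2 : 2 * (α.im / 2) = α.im := by omega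
    have h3 : (ω.re ^ 2 + ω.im ^ 2).toNat = t := by
      rw [hω', Int.toNat_natCast]
    rw [h1, h2, h3]
  · intro w hw
    rw [mem_quadSet] at hw
    show (-1 : ℤ) ^ w.1.2.natAbs * (-1) ^ w.2.natAbs = (-1) ^ (w.1.2 ^ 2 + w.2 ^ 2).toNat
    have ht0 : 0 ≤ w.1.2 ^ 2 + w.2 ^ 2 := by positivity
    rw [← pow_add, neg_one_pow_eq_pow_mod_two (n := w.1.2.natAbs + w.2.natAbs),
      neg_one_pow_eq_pow_mod_two (n := (w.1.2 ^ 2 + w.2 ^ 2).toNat)]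
    congr 1
    have h1 := sq_emod_two w.1.2
    have h2 := sq_emod_two w.2
    have : ((w.1.2 ^ 2 + w.2 ^ 2).toNat : ℤ) = w.1.2 ^ 2 + w.2 ^ 2 := Int.toNat_of_nonneg ht0
    omega

end Literature.NumberTheory.EllipticCurves.Tunnell1983

/-! ## Assembly — `d₈(p²) + 1 = S(p) = a_p(E)` at `p ≡ 1 (mod 4)`, given Jacobi's identity -/

namespace Literature.NumberTheory.EllipticCurves.Tunnell1983

local notation "ℤ[i]" => GaussianInt

open Literature.NumberTheory.QuadraticFields.GaussianPrimary Finset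
open Literature.NumberTheory.LFunctions.GaussianTheta (normEq mem_normEq normEq_zero)
open Literature.NumberTheory.EllipticCurves.ModularForms

section Assembly

variable {p : ℕ}

/-- **`2 Q(p) = 4 d₈(p²) + 4`** for a prime `p ≡ 1 (mod 4)`: in (E1), `2 #oddRe(p - 4t) = r₂(p - 4t)`
and `r₂(p - 4t) r₂(t) = 4 r₂(t(p - 4t))` for `t ≥ 1` (`gcd(p - 4t, t) = 1`), `r₂(p) = 8`; compare
with Step A. [folklore] -/
theorem two_mul_quadSum_prime (hp : p.Prime) (hp1 : p % 4 = 1) :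
    2 * quadSum p = 4 * formCoeff 8 (p ^ 2) + 4 := by
  rw [quadSum_eq_sum_card (by omega : p % 2 = 1), formCoeff_eight_sq_eq_sum hp1]
  rw [Finset.mul_sum (Finset.range (p / 4 + 1)), Finset.mul_sum (Finset.range (p / 4 + 1))]
  rw [Finset.sum_range_succ']
  rw [Finset.sum_range_succ']
  rw [add_assoc]
  have h8 : (normEq p).card = 8 := card_normEq_prime hp hp1
  have hodd0 : 2 * (oddRe p).card = 8 := by rw [← h8]; exact card_filter_re_odd (by omega)
  congr 1
  · refine Finset.sum_congr rfl fun t ht ↦ ?_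
    rw [Finset.mem_range] at ht
    have hu4 : 4 * (t + 1) < p := by omega
    have hodd : (p - 4 * (t + 1)) % 2 = 1 := by omega
    have hne : p - 4 * (t + 1) ≠ 0 := by omega
    have hcop : (p - 4 * (t + 1)).Coprime (t + 1) := by
      have h1 : p.Coprime (4 * (t + 1)) := Nat.coprime_of_lt_prime (by omega) hu4 hp
      have h2 : (p - 4 * (t + 1)).Coprime (4 * (t + 1)) := (Nat.coprime_sub_self_left hu4.le).mpr h1
      exact h2.coprime_dvd_right ⟨4, by ring⟩
    have hc1 : 2 * (oddRe (p - 4 * (t + 1))).card = (normEq (p - 4 * (t + 1))).card :=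
      card_filter_re_odd hodd
    have hc2 := card_normEq_mul_card_normEq hcop hne
    rw [mul_comm (p - 4 * (t + 1)) (t + 1)] at hc2
    have hc1' : (2 : ℤ) * (oddRe (p - 4 * (t + 1))).card = (normEq (p - 4 * (t + 1))).card := by
      exact_mod_cast hc1
    have hc2' : ((normEq (p - 4 * (t + 1))).card : ℤ) * (normEq (t + 1)).card =
        4 * (normEq ((t + 1) * (p - 4 * (t + 1)))).card := by exact_mod_cast hc2
    linear_combination ((-1 : ℤ) ^ (t + 1) * ((normEq (t + 1)).card : ℤ)) * hc1' +
      (-1 : ℤ) ^ (t + 1) * hc2'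
  · have hodd0' : (2 : ℤ) * (oddRe p).card = 8 := by exact_mod_cast hodd0
    simp only [pow_zero, one_mul, Nat.mul_zero, Nat.sub_zero, zero_mul, card_normEq_zero, Nat.cast_one,
      mul_one]
    linear_combination hodd0'

/-- **`Q(p) = 2 S(p)`**, given Jacobi's identity. [folklore] -/
theorem quadSum_eq_two_mul_re_primarySum (hJ : ∀ M : ℕ, jacobiRHS M = jacobiLHS M) (m : ℕ) :
    quadSum m = 2 * (primarySum m).re :=
  (quadSum_eq_pairSum hJ m).trans (pairSum_eq_two_mul_re_primarySum m)

/-- **`d₈(p²) + 1 = Re S(p)`** for a prime `p ≡ 1 (mod 4)`, given Jacobi's identity `J_R = J_L`.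
[folklore] -/
theorem formCoeff_eight_prime_sq_add_one (hJ : ∀ M : ℕ, jacobiRHS M = jacobiLHS M) (hp : p.Prime)
    (hp1 : p % 4 = 1) : formCoeff 8 (p ^ 2) + 1 = (primarySum p).re := by
  have h1 := two_mul_quadSum_prime hp hp1
  have h2 := quadSum_eq_two_mul_re_primarySum hJ p
  linarith

/-- **`a_p(E) = Re S(p)`** (`E : y² = x³ - x`; Ireland–Rosen Thm. 18.5, in the tree's form
`a_m(E₁) = (1/m) S(m)`). [cite: IrelandRosen1990, Ch. 18 §4 Theorem 5] -/
theorem lFunction_congruentNumberCurve_one_eq_re_primarySum (hp : p.Prime) :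
    (congruentNumberCurve 1).LFunction p = (primarySum p).re := by
  have h := lFunction_congruentNumberCurve_eq_jacobiSym_mul_primarySum (n := 1) squarefree_one
    IrelandRosen1990_card_points_one_mod_four_holds (m := p) hp.ne_zero
  rw [Nat.cast_one, jacobiSym.one_left, Int.cast_one, one_mul] at h
  have := congrArg Zsqrtd.re h
  simpa using this

/-- **The ordinary half of the Shimura–Niwa input for `g θ₈`, given Jacobi's identity**: for a
prime `p ≡ 1 (mod 4)` the coefficient of `q¹` of `T(p²)(g θ₈)`, i.e. its `T(p²)`-eigenvalue
`d₈(p²) + (-1/p) = d₈(p²) + 1`, equals `a_p(E)` (Tunnell 1983, proof of Thm 2: the eigenvalues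
of `g θ₈` are those of `φ`). [cite: Tunnell1983Congruent, Thm 2 and its proof, pp. 327–328] -/
theorem heckeTSq_tunnellForm_eight_one_eq_of_jacobi (hJ : ∀ M : ℕ, jacobiRHS M = jacobiLHS M)
    (hp : p.Prime) (hp1 : p % 4 = 1) :
    heckeTSq 3 (1 : DirichletCharacter ℂ 128) p (qCoeffs (tunnellForm 8)) 1 = tunnellEigenvalues p := by
  have hp2 : p ≠ 2 := by omega
  have hunit : IsUnit ((p : ℕ) : ZMod 128) := by
    rw [ZMod.isUnit_iff_coprime]
    exact Nat.Coprime.pow_right 7 ((Nat.coprime_primes hp Nat.prime_two).mpr hp2)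
  have hndvd : ¬ p ^ 2 ∣ 1 := by
    intro h
    have h1 : p ^ 2 ≤ 1 := Nat.le_of_dvd one_pos h
    nlinarith [hp.two_le]
  rw [heckeTSq_three_apply, qCoeffs_tunnellForm (by norm_num : 0 < 8), if_neg hndvd]
  simp only [mul_one, Nat.cast_one, mul_zero, add_zero, MulChar.one_apply hunit, one_mul]
  rw [formCoeff_eight_one, jacobiSym.at_neg_one (hp.odd_of_ne_two hp2), ZMod.χ₄_nat_one_mod_four hp1,
    tunnellEigenvalues, lFunction_congruentNumberCurve_one_eq_re_primarySum hp,
    ← formCoeff_eight_prime_sq_add_one hJ hp hp1]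
  push_cast
  ring

/-- **`T(p²)(g θ₈) = a_p(E) · g θ₈` for primes `p ≡ 1 (mod 4)`, given Jacobi's identity.**
[cite: Tunnell1983Congruent, Thm 2 and its proof, pp. 327–328] -/
theorem heckeTSq_tunnellForm_eight_ordinary_of_jacobi (hJ : ∀ M : ℕ, jacobiRHS M = jacobiLHS M)
    (hp : p.Prime) (hp1 : p % 4 = 1) :
    heckeTSq 3 (1 : DirichletCharacter ℂ 128) p (qCoeffs (tunnellForm 8)) =
      tunnellEigenvalues p • qCoeffs (tunnellForm 8) := by
  rw [heckeTSq_tunnellForm_eight_eigen hp (by omega), heckeTSq_tunnellForm_eight_one_eq_of_jacobi hJ hp hp1]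

/-- **`T(p²)(g θ₈) = a_p(E) · g θ₈` for every odd prime `p`, given Jacobi's identity** (Tunnell
1983, Theorem 2 for `g θ₈`): the ordinary primes by the above, the supersingular primes by
`heckeTSq_tunnellForm_eight_supersingular`. [cite: Tunnell1983Congruent, Thm 2, p. 327] -/
theorem heckeTSq_tunnellForm_eight_of_jacobi (hJ : ∀ M : ℕ, jacobiRHS M = jacobiLHS M)
    (hp : p.Prime) (hp2 : p ≠ 2) :
    heckeTSq 3 (1 : DirichletCharacter ℂ 128) p (qCoeffs (tunnellForm 8)) =
      tunnellEigenvalues p • qCoeffs (tunnellForm 8) := by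
  have hodd := hp.odd_of_ne_two hp2
  rcases Nat.odd_mod_four_iff.mp (Nat.odd_iff.mp hodd) with h1 | h3
  · exact heckeTSq_tunnellForm_eight_ordinary_of_jacobi hJ hp h1
  · exact heckeTSq_tunnellForm_eight_supersingular hp h3

end Assembly

end Literature.NumberTheory.EllipticCurves.Tunnell1983

/-! ## Jacobi's identity at `τ = 8z` — `J_R = J_L` from `θ₁' = θ₂ θ₃ θ₄` -/

namespace Literature.NumberTheory.EllipticCurves.Tunnell1983

open Complex Real Function Literature.NumberTheory.EllipticCurves.JacobiThetaNull
open Literature.NumberTheory.EllipticCurves.ModularForms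

open scoped UpperHalfPlane

section QSeries

/-- `e^{πin} = (-1)^{|n|}` for `n ∈ ℤ`. [folklore] -/
theorem cexp_pi_I_int (n : ℤ) : cexp (π * I * n) = (-1 : ℂ) ^ n.natAbs := by
  obtain ⟨k, rfl | rfl⟩ := Int.eq_nat_or_neg n
  · rw [Int.natAbs_natCast, Int.cast_natCast, show (π * I * (k : ℂ)) = (k : ℂ) * (π * I) by ring,
      Complex.exp_nat_mul, Complex.exp_pi_mul_I]
  · rw [Int.natAbs_neg, Int.natAbs_natCast, Int.cast_neg, Int.cast_natCast,
      show (π * I * -(k : ℂ)) = -((k : ℂ) * (π * I)) by ring, Complex.exp_neg, Complex.exp_nat_mul,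
      Complex.exp_pi_mul_I, ← inv_pow, inv_neg_one]

variable (z : ℍ)

/-- `Im (8z) > 0`. [folklore] -/
theorem im_eight_mul_pos : 0 < im (8 * (z : ℂ)) := by
  simpa using mul_pos (by norm_num : (0 : ℝ) < 8) z.im_pos

/-- The exponent `πi · 8z · (n² + n + ¼) = 2πi (2n+1)² z`. [folklore] -/
theorem exp_odd_sq (n : ℤ) :
    cexp (π * I * (8 * (z : ℂ)) / 4) * cexp (2 * π * I * n * ((8 * (z : ℂ)) / 2) + π * I * n ^ 2 * (8 * (z : ℂ))) =
      Periodic.qParam 1 z ^ ((2 * n + 1) ^ 2).toNat := by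
  rw [← Complex.exp_add, ← cexp_two_pi_I_natCast]
  congr 1
  have h : ((((2 * n + 1) ^ 2).toNat : ℕ) : ℂ) = (((2 * n + 1) ^ 2 : ℤ) : ℂ) := by
    have : ((((2 * n + 1) ^ 2).toNat : ℕ) : ℤ) = (2 * n + 1) ^ 2 := Int.toNat_of_nonneg (sq_nonneg _)
    exact_mod_cast this
  rw [h]
  push_cast
  ring

/-- The exponent at the half period: `πi·8z/4 + 2πi n (1 + 8z)/2 + πi n² 8z = πin + 2πi(2n+1)²z`.
[folklore] -/
theorem exp_odd_sq_halfPeriod (n : ℤ) :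
    cexp (π * I * (8 * (z : ℂ)) / 4) *
        cexp (2 * π * I * n * ((1 + 8 * (z : ℂ)) / 2) + π * I * n ^ 2 * (8 * (z : ℂ))) =
      (-1 : ℂ) ^ n.natAbs * Periodic.qParam 1 z ^ ((2 * n + 1) ^ 2).toNat := by
  rw [← exp_odd_sq z n, ← cexp_pi_I_int, ← Complex.exp_add, ← Complex.exp_add, ← Complex.exp_add]
  congr 1
  ring

/-- `πi n² · 8z = 2πi (4n²) z`: the `θ₃`-terms at `8z`. [folklore] -/
theorem exp_four_sq (n : ℤ) :
    cexp (2 * π * I * n * 0 + π * I * n ^ 2 * (8 * (z : ℂ))) = Periodic.qParam 1 z ^ (4 * n ^ 2).toNat := by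
  rw [← cexp_two_pi_I_natCast]
  congr 1
  have h : (((4 * n ^ 2).toNat : ℕ) : ℂ) = (((4 * n ^ 2) : ℤ) : ℂ) := by
    have : (((4 * n ^ 2).toNat : ℕ) : ℤ) = 4 * n ^ 2 := Int.toNat_of_nonneg (by positivity)
    exact_mod_cast this
  rw [h]
  push_cast
  ring

/-- The `θ₄`-terms at `8z`: `e^{πin} q^{4n²}`. [folklore] -/
theorem exp_four_sq_half (n : ℤ) :
    cexp (2 * π * I * n * (1 / 2) + π * I * n ^ 2 * (8 * (z : ℂ))) =
      (-1 : ℂ) ^ n.natAbs * Periodic.qParam 1 z ^ (4 * n ^ 2).toNat := by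
  rw [← exp_four_sq z n, ← cexp_pi_I_int, ← Complex.exp_add]
  congr 1
  ring

/-- The terms `q^{(2n+1)²}` of `θ₂(8z)`. [folklore] -/
def termA (n : ℤ) : ℂ := Periodic.qParam 1 z ^ ((2 * n + 1) ^ 2).toNat

/-- The terms `q^{4n²}` of `θ₃(8z)`. [folklore] -/
def termB (n : ℤ) : ℂ := Periodic.qParam 1 z ^ (4 * n ^ 2).toNat

/-- The terms `(-1)ⁿ q^{4n²}` of `θ₄(8z)`. [folklore] -/
def termC (n : ℤ) : ℂ := (-1 : ℂ) ^ n.natAbs * Periodic.qParam 1 z ^ (4 * n ^ 2).toNat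

/-- The terms `(-1)ⁿ (2n+1) q^{(2n+1)²}` of `D(8z)`. [folklore] -/
def termD (n : ℤ) : ℂ := (-1 : ℂ) ^ n.natAbs * (2 * n + 1) * Periodic.qParam 1 z ^ ((2 * n + 1) ^ 2).toNat

/-- **`D(8z) = ∑ (-1)ⁿ (2n+1) q^{(2n+1)²}`** (Lawden (1.5.7) at `q ↦ q⁴ = e^{8πiz}`). [folklore] -/
theorem hasSum_theta1'_eight : HasSum (termD z) (theta1' (8 * (z : ℂ))) := by
  set τ : ℂ := 8 * (z : ℂ) with hτ
  have hτ0 : 0 < im τ := im_eight_mul_pos z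
  have hπ : (π : ℂ) * I ≠ 0 := mul_ne_zero (ofReal_ne_zero.mpr pi_ne_zero) I_ne_zero
  -- the derivative series
  have h1 := (hasSum_jacobiTheta₂'_term ((1 + τ) / 2) hτ0).mul_left (cexp (π * I * τ / 4) / (π * I))
  -- the null series
  have h2 := (hasSum_jacobiTheta₂_term ((1 + τ) / 2) hτ0).mul_left (cexp (π * I * τ / 4))
  rw [jacobiTheta₂_halfPeriod, mul_zero] at h2
  have h := h1.add h2
  rw [add_zero] at h
  refine h.congr_fun fun n ↦ ?_
  simp only [jacobiTheta₂'_term, jacobiTheta₂_term, termD]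
  have e := exp_odd_sq_halfPeriod z n
  rw [hτ]
  symm
  calc cexp (π * I * (8 * (z : ℂ)) / 4) / (π * I) *
        (2 * π * I * n * cexp (2 * π * I * n * ((1 + 8 * (z : ℂ)) / 2) + π * I * n ^ 2 * (8 * (z : ℂ)))) +
        cexp (π * I * (8 * (z : ℂ)) / 4) *
          cexp (2 * π * I * n * ((1 + 8 * (z : ℂ)) / 2) + π * I * n ^ 2 * (8 * (z : ℂ)))
      = (2 * n + 1) * (cexp (π * I * (8 * (z : ℂ)) / 4) *
          cexp (2 * π * I * n * ((1 + 8 * (z : ℂ)) / 2) + π * I * n ^ 2 * (8 * (z : ℂ)))) := by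
        field_simp
    _ = _ := by rw [e]; ring

/-- The `θ₂`-series at `8z`: `∑ q^{(2n+1)²}`. [folklore] -/
theorem hasSum_theta2_eight : HasSum (termA z) (theta2 (8 * (z : ℂ))) := by
  have h := (hasSum_jacobiTheta₂_term ((8 * (z : ℂ)) / 2) (im_eight_mul_pos z)).mul_left
    (cexp (π * I * (8 * (z : ℂ)) / 4))
  refine h.congr_fun fun n ↦ ?_
  simp only [jacobiTheta₂_term, termA]
  exact (exp_odd_sq z n).symm

/-- The `θ₃`-series at `8z`: `∑ q^{4n²}`. [folklore] -/
theorem hasSum_theta3_eight : HasSum (termB z) (theta3 (8 * (z : ℂ))) := by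
  have h := hasSum_jacobiTheta₂_term 0 (im_eight_mul_pos z)
  refine h.congr_fun fun n ↦ ?_
  simp only [jacobiTheta₂_term, termB]
  exact (exp_four_sq z n).symm

/-- The `θ₄`-series at `8z`: `∑ (-1)ⁿ q^{4n²}`. [folklore] -/
theorem hasSum_theta4_eight : HasSum (termC z) (theta4 (8 * (z : ℂ))) := by
  have h := hasSum_jacobiTheta₂_term (1 / 2) (im_eight_mul_pos z)
  refine h.congr_fun fun n ↦ ?_
  simp only [jacobiTheta₂_term, termC]
  exact (exp_four_sq_half z n).symm

/-- `‖qᵉ‖ = e^{-2π e Im z}` for the powers appearing. [folklore] -/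
theorem norm_qParam_pow_toNat {e : ℤ} (he : 0 ≤ e) :
    ‖Periodic.qParam 1 z ^ e.toNat‖ = Real.exp (-(2 * Real.pi * z.im) * e) := by
  rw [← cexp_two_pi_I_natCast, show ((e.toNat : ℕ) : ℂ) = ((e : ℤ) : ℂ) by
    have : ((e.toNat : ℕ) : ℤ) = e := Int.toNat_of_nonneg he
    exact_mod_cast this, norm_cexp_two_pi_I]

/-- Summability of `∑ ‖q^{4n²}‖`. [folklore] -/
theorem summable_norm_termB : Summable (fun n : ℤ ↦ ‖termB z n‖) := by
  have hc : 0 < 2 * Real.pi * z.im := by positivity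
  refine Summable.of_nonneg_of_le (fun _ ↦ norm_nonneg _) (fun n ↦ ?_) (summable_exp_neg_mul_sq hc)
  rw [termB, norm_qParam_pow_toNat z (by positivity), Real.exp_le_exp]
  push_cast
  nlinarith [sq_nonneg (n : ℝ), Real.pi_pos, z.im_pos]

/-- Summability of `∑ ‖(-1)ⁿ q^{4n²}‖`. [folklore] -/
theorem summable_norm_termC : Summable (fun n : ℤ ↦ ‖termC z n‖) := by
  refine (summable_norm_termB z).congr fun n ↦ ?_
  rw [termB, termC, norm_mul, norm_pow (-1 : ℂ), norm_neg, norm_one, one_pow, one_mul]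

/-- Summability of `∑ ‖q^{(2n+1)²}‖`. [folklore] -/
theorem summable_norm_termA : Summable (fun n : ℤ ↦ ‖termA z n‖) := by
  have hc : 0 < 2 * Real.pi * z.im := by positivity
  refine Summable.of_nonneg_of_le (fun _ ↦ norm_nonneg _) (fun n ↦ ?_) (summable_exp_neg_mul_sq hc)
  rw [termA, norm_qParam_pow_toNat z (sq_nonneg _), Real.exp_le_exp]
  push_cast
  have : (n : ℝ) ^ 2 ≤ (2 * n + 1) ^ 2 := by
    have hi : n ^ 2 ≤ (2 * n + 1) ^ 2 := by
      rcases le_or_gt 0 n with h | h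
      · nlinarith
      · have h1 : 0 ≤ -n - 1 := by omega
        have h2 : 0 ≤ -3 * n - 1 := by omega
        nlinarith [mul_nonneg h1 h2]
    exact_mod_cast hi
  nlinarith [Real.pi_pos, z.im_pos, this]

/-- Summability of the double series `∑ ‖termA · termB‖`. [folklore] -/
theorem summable_norm_termAB : Summable (fun x : ℤ × ℤ ↦ ‖termA z x.1 * termB z x.2‖) := by
  have := summable_mul_of_summable_norm (f := fun n : ℤ ↦ ‖termA z n‖) (g := fun n : ℤ ↦ ‖termB z n‖)
    (by simpa only [norm_norm] using summable_norm_termA z)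
    (by simpa only [norm_norm] using summable_norm_termB z)
  exact this.congr fun x ↦ (norm_mul _ _).symm

/-- The double series `θ₂θ₃(8z) = ∑ termA · termB`. [folklore] -/
theorem hasSum_thetaAB :
    HasSum (fun x : ℤ × ℤ ↦ termA z x.1 * termB z x.2) (theta2 (8 * (z : ℂ)) * theta3 (8 * (z : ℂ))) :=
  (hasSum_theta2_eight z).mul (hasSum_theta3_eight z)
    (summable_mul_of_summable_norm (summable_norm_termA z) (summable_norm_termB z))

/-- The triple series `θ₂θ₃θ₄(8z) = ∑ termA · termB · termC`. [folklore] -/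
theorem hasSum_thetaABC :
    HasSum (fun v : (ℤ × ℤ) × ℤ ↦ (termA z v.1.1 * termB z v.1.2) * termC z v.2)
      (theta2 (8 * (z : ℂ)) * theta3 (8 * (z : ℂ)) * theta4 (8 * (z : ℂ))) := by
  have hs : Summable (fun v : (ℤ × ℤ) × ℤ ↦ (termA z v.1.1 * termB z v.1.2) * termC z v.2) :=
    summable_mul_of_summable_norm (f := fun x : ℤ × ℤ ↦ termA z x.1 * termB z x.2) (g := termC z)
      (summable_norm_termAB z) (summable_norm_termC z)
  exact (hasSum_thetaAB z).mul (hasSum_theta4_eight z) hs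

/-- `toNat` of a sum of three nonnegative integers. [folklore] -/
theorem toNat_add_three {a b c : ℤ} (ha : 0 ≤ a) (hb : 0 ≤ b) (hc : 0 ≤ c) :
    (a + b + c).toNat = a.toNat + b.toNat + c.toNat := by
  rw [Int.toNat_add (add_nonneg ha hb) hc, Int.toNat_add ha hb]

/-- **`θ₂θ₃θ₄(8z) = ∑_{(n,a,y)} (-1)ʸ q^{(2n+1)² + 4a² + 4y²}`** (the triple series). [folklore] -/
theorem hasSum_thetaP_eight :
    HasSum (fun v : (ℤ × ℤ) × ℤ ↦ (-1 : ℂ) ^ v.2.natAbs *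
        Periodic.qParam 1 z ^ ((2 * v.1.1 + 1) ^ 2 + 4 * v.1.2 ^ 2 + 4 * v.2 ^ 2).toNat)
      (theta2 (8 * (z : ℂ)) * theta3 (8 * (z : ℂ)) * theta4 (8 * (z : ℂ))) := by
  refine (hasSum_thetaABC z).congr_fun fun v ↦ ?_
  have e1 : 0 ≤ (2 * v.1.1 + 1) ^ 2 := sq_nonneg _
  have e2 : 0 ≤ 4 * v.1.2 ^ 2 := by positivity
  have e3 : 0 ≤ 4 * v.2 ^ 2 := by positivity
  simp only [termA, termB, termC]
  rw [toNat_add_three e1 e2 e3, pow_add, pow_add]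
  ring

/-- Regrouping a `q`-series over `ℤ` by the exponent. [folklore] -/
theorem hasSum_nat_of_hasSum_int {a : ℤ → ℂ} {E : ℤ → ℤ} {S : ℂ} (hE : ∀ n, 0 ≤ E n)
    (hbox : ∀ n (N : ℕ), E n = N → n ∈ Finset.Icc (-(N : ℤ)) N)
    (h : HasSum (fun n ↦ a n * Periodic.qParam 1 z ^ (E n).toNat) S) :
    HasSum (fun N : ℕ ↦ (∑ n ∈ Finset.Icc (-(N : ℤ)) N, if E n = N then a n else 0) * Periodic.qParam 1 z ^ N) S := by
  classical
  set F : ℤ → ℕ := fun n ↦ (E n).toNat with hF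
  have hfib : ∀ n (N : ℕ), n ∈ F ⁻¹' {N} ↔ E n = N := fun n N ↦ by
    simp only [Set.mem_preimage, Set.mem_singleton_iff, hF]
    constructor
    · intro h'; rw [← Int.toNat_of_nonneg (hE n), h']
    · intro h'; rw [h', Int.toNat_natCast]
  have h' := h.tsum_fiberwise F
  refine h'.congr_fun fun N ↦ ?_
  symm
  rw [tsum_subtype (F ⁻¹' {N}) (fun n ↦ a n * Periodic.qParam 1 z ^ (E n).toNat),
    tsum_eq_sum (s := Finset.Icc (-(N : ℤ)) N)]
  · rw [Finset.sum_mul]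
    refine Finset.sum_congr rfl fun n _ ↦ ?_
    rw [Set.indicator_apply]
    by_cases hn : E n = N
    · rw [if_pos ((hfib n N).mpr hn), if_pos hn, hn, Int.toNat_natCast]
    · rw [if_neg (fun h'' ↦ hn ((hfib n N).mp h'')), if_neg hn, zero_mul]
  · intro n hn
    rw [Set.indicator_of_notMem]
    intro hmem
    exact hn (hbox n N ((hfib n N).mp hmem))

/-- The same for a `q`-series over `(ℤ × ℤ) × ℤ`. [folklore] -/
theorem hasSum_nat_of_hasSum_int3 {a : (ℤ × ℤ) × ℤ → ℂ} {E : (ℤ × ℤ) × ℤ → ℤ} {S : ℂ} (hE : ∀ v, 0 ≤ E v)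
    (hbox : ∀ v (N : ℕ), E v = N →
      v ∈ (Finset.Icc (-(N : ℤ)) N ×ˢ Finset.Icc (-(N : ℤ)) N) ×ˢ Finset.Icc (-(N : ℤ)) N)
    (h : HasSum (fun v ↦ a v * Periodic.qParam 1 z ^ (E v).toNat) S) :
    HasSum (fun N : ℕ ↦ (∑ v ∈ (Finset.Icc (-(N : ℤ)) N ×ˢ Finset.Icc (-(N : ℤ)) N) ×ˢ Finset.Icc (-(N : ℤ)) N,
      if E v = N then a v else 0) * Periodic.qParam 1 z ^ N) S := by
  classical
  set F : (ℤ × ℤ) × ℤ → ℕ := fun v ↦ (E v).toNat with hF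
  have hfib : ∀ v (N : ℕ), v ∈ F ⁻¹' {N} ↔ E v = N := fun v N ↦ by
    simp only [Set.mem_preimage, Set.mem_singleton_iff, hF]
    constructor
    · intro h'; rw [← Int.toNat_of_nonneg (hE v), h']
    · intro h'; rw [h', Int.toNat_natCast]
  have h' := h.tsum_fiberwise F
  refine h'.congr_fun fun N ↦ ?_
  symm
  rw [tsum_subtype (F ⁻¹' {N}) (fun v ↦ a v * Periodic.qParam 1 z ^ (E v).toNat),
    tsum_eq_sum (s := (Finset.Icc (-(N : ℤ)) N ×ˢ Finset.Icc (-(N : ℤ)) N) ×ˢ Finset.Icc (-(N : ℤ)) N)]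
  · rw [Finset.sum_mul]
    refine Finset.sum_congr rfl fun v _ ↦ ?_
    rw [Set.indicator_apply]
    by_cases hv : E v = N
    · rw [if_pos ((hfib v N).mpr hv), if_pos hv, hv, Int.toNat_natCast]
    · rw [if_neg (fun h'' ↦ hv ((hfib v N).mp h'')), if_neg hv, zero_mul]
  · intro v hv
    rw [Set.indicator_of_notMem]
    intro hmem
    exact hv (hbox v N ((hfib v N).mp hmem))

/-- **`D(8z) = ∑_N J_L(N) q^N`.** [folklore] -/
theorem hasSum_jacobiLHS :
    HasSum (fun N : ℕ ↦ (jacobiLHS N : ℂ) * Periodic.qParam 1 z ^ N) (theta1' (8 * (z : ℂ))) := by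
  have hD : HasSum (fun n : ℤ ↦ ((-1 : ℂ) ^ n.natAbs * (2 * n + 1)) *
      Periodic.qParam 1 z ^ ((2 * n + 1) ^ 2).toNat) (theta1' (8 * (z : ℂ))) := hasSum_theta1'_eight z
  have h := hasSum_nat_of_hasSum_int z (a := fun n : ℤ ↦ (-1 : ℂ) ^ n.natAbs * (2 * n + 1))
    (E := fun n ↦ (2 * n + 1) ^ 2) (fun n ↦ sq_nonneg _) (fun n N hn ↦ by
      have := natAbs_le_sq_two_mul_add_one n
      rw [Finset.mem_Icc]; constructor <;> omega) hD
  refine h.congr_fun fun N ↦ ?_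
  simp only [jacobiLHS]
  push_cast
  rfl

/-- **`θ₂θ₃θ₄(8z) = ∑_N J_R(N) q^N`.** [folklore] -/
theorem hasSum_jacobiRHS :
    HasSum (fun N : ℕ ↦ (jacobiRHS N : ℂ) * Periodic.qParam 1 z ^ N)
      (theta2 (8 * (z : ℂ)) * theta3 (8 * (z : ℂ)) * theta4 (8 * (z : ℂ))) := by
  have h := hasSum_nat_of_hasSum_int3 z (a := fun v : (ℤ × ℤ) × ℤ ↦ (-1 : ℂ) ^ v.2.natAbs)
    (E := fun v ↦ (2 * v.1.1 + 1) ^ 2 + 4 * v.1.2 ^ 2 + 4 * v.2 ^ 2) (fun v ↦ by positivity)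
    (fun v N hv ↦ (mem_tripleSet.mpr hv |> fun h ↦ (Finset.mem_filter.mp h).1)) (hasSum_thetaP_eight z)
  refine h.congr_fun fun N ↦ ?_
  simp only [jacobiRHS]
  push_cast
  rfl

end QSeries

/-- **Jacobi's identity `θ₁' = θ₂θ₃θ₄` at `τ = 8z`, coefficientwise**: for every `N`,
`∑_{(n,a,y) : (2n+1)² + 4a² + 4y² = N} (-1)ʸ = ∑_{n : (2n+1)² = N} (-1)ⁿ (2n+1)`
(Lawden (1.5.11) with `q ↦ q⁴`: `∑ (-1)ⁿ(2n+1) q^{(2n+1)²} = (∑ q^{(2n+1)²})(∑ q^{4n²})(∑ (-1)ⁿ q^{4n²})`).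
[cite: Lawden1989, §1.5 eq. (1.5.11)] -/
theorem jacobiRHS_eq_jacobiLHS (N : ℕ) : jacobiRHS N = jacobiLHS N := by
  set f : ℍ → ℂ := fun z ↦ theta1' (8 * (z : ℂ)) with hf
  have h1 : qCoeffs f = fun N ↦ (jacobiLHS N : ℂ) := qCoeffs_eq_of_hasSum (fun z ↦ hasSum_jacobiLHS z)
  have h2 : qCoeffs f = fun N ↦ (jacobiRHS N : ℂ) := by
    refine qCoeffs_eq_of_hasSum (fun z ↦ ?_)
    rw [hf]
    simp only
    rw [jacobi_derivative_formula]
    exact hasSum_jacobiRHS z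
  have := congrFun (h1.symm.trans h2) N
  exact_mod_cast this.symm

/-! ## The ordinary half of (SN) for `g θ₈`, unconditionally -/

section Unconditional

variable {p : ℕ}

/-- **`d₈(p²) + 1 = a_p(E)`** for every prime `p ≡ 1 (mod 4)` (`g θ₈ = ∑ d₈(n) qⁿ`,
`E : y² = x³ - x`): the `T(p²)`-eigenvalue of `g θ₈` at the ordinary primes is that of `φ`
(Tunnell 1983, proof of Thm 2, which invokes Shimura [18] and Niwa [11]; here by Jacobi's
`θ₁' = θ₂θ₃θ₄` and unique factorisation in `ℤ[i]`). [cite: Tunnell1983Congruent, proof of Thm 2, pp. 327–328] -/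
theorem formCoeff_eight_prime_sq_ordinary (hp : p.Prime) (hp1 : p % 4 = 1) :
    (formCoeff 8 (p ^ 2) : ℂ) + 1 = tunnellEigenvalues p := by
  rw [tunnellEigenvalues, lFunction_congruentNumberCurve_one_eq_re_primarySum hp,
    ← formCoeff_eight_prime_sq_add_one jacobiRHS_eq_jacobiLHS hp hp1]
  push_cast
  ring

/-- **`T(p²)(g θ₈) = a_p(E) · g θ₈` for primes `p ≡ 1 (mod 4)`.**
[cite: Tunnell1983Congruent, Thm 2 and its proof, pp. 327–328] -/
theorem heckeTSq_tunnellForm_eight_ordinary (hp : p.Prime) (hp1 : p % 4 = 1) :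
    heckeTSq 3 (1 : DirichletCharacter ℂ 128) p (qCoeffs (tunnellForm 8)) =
      tunnellEigenvalues p • qCoeffs (tunnellForm 8) :=
  heckeTSq_tunnellForm_eight_ordinary_of_jacobi jacobiRHS_eq_jacobiLHS hp hp1

/-- **Tunnell 1983, Theorem 2 for `g θ₈` (Hecke form): `T(p²)(g θ₈) = a_p(E) · g θ₈` for every
odd prime `p`**, unconditionally — the Shimura–Niwa input (SN) for `g θ₈` PROVED: supersingular
primes by `heckeTSq_tunnellForm_eight_supersingular`, ordinary primes by Jacobi's derivative
formula. [cite: Tunnell1983Congruent, Thm 2, p. 327] -/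
theorem heckeTSq_tunnellForm_eight (hp : p.Prime) (hp2 : p ≠ 2) :
    heckeTSq 3 (1 : DirichletCharacter ℂ 128) p (qCoeffs (tunnellForm 8)) =
      tunnellEigenvalues p • qCoeffs (tunnellForm 8) :=
  heckeTSq_tunnellForm_eight_of_jacobi jacobiRHS_eq_jacobiLHS hp hp2

end Unconditional

end Literature.NumberTheory.EllipticCurves.Tunnell1983
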